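import Mathlib.Analysis.Calculus.Deriv.Star
import Literature.Probability.LatticeModels.FlatBoundaryPoissonKernelLimit
import Literature.Probability.LatticeModels.LatticePotentialKernelAsymptotics
import Literature.Probability.LatticeModels.DirichletGreenFunction
import Literature.Probability.LatticeModels.HarmonicFlatBoundaryRow
import Literature.Probability.LatticeModels.DomainDiscretisation
import Literature.Probability.LatticeModels.LatticeDirichletInteriorConvergence
import Literature.Probability.RandomPlanarGeometry.GreenPotentialBoundary
import Literature.Probability.RandomPlanarGeometry.RectilinearJordanLocalStructure
import HarnessLib

/-!
# Proof of Kenyon's flat-edge Poisson kernel limit (`Kenyon2000_flatEdgePoissonKernelLimit_holds`)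

Topic `Literature/Probability/LatticeModels`. This file discharges the named fact
`Kenyon2000_flatEdgePoissonKernelLimit` (Kenyon 2000, Cor. 19 with Thm 14 / Lemma 17; stated in
`FlatBoundaryPoissonKernelLimit.lean`): for a rectilinear Jordan domain `D`, a flat boundary
point `x`, a conformal `w : D → ℍ` holomorphic near `x`, meshes `δₙ → 0`, `Vₙ = δₙℤ² ∩ closure D`,
poles `δₙcₙ → u ∈ D` and boundary sites `δₙaₙ → x` with exactly one neighbour off `Vₙ`,
`G_{Vₙ}(cₙ, aₙ)/δₙ → π⁻¹ im w(u) |w′(x)| / |w(u) - w(x)|²`.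

## Architecture

0. **Normalisation by the potential kernel** (`greenNormalised_data`, `abs_dirichletGreen_le_of_far`,
   `tendsto_potentialNormalised`; Kenyon 2000, Thm 13 / proof of Lemma 17): with
   `a = latticePotentialKernel 2` (`Δ a = 2δ₀`, `a(y) - (2π)⁻¹ log (y₀² + y₁²) → κ`,
   `LatticePotentialKernelAsymptotics`), `hₙ = G_{Vₙ}(cₙ, ·)` and `Lₙ = -(2π)⁻¹ log δₙ + κ/2`,
   the function `Fₙ = hₙ + a(· - cₙ)/2 - Lₙ` is lattice harmonic on `Vₙ`
   (`isLatticeHarmonicOn_greenNormalised`), equals `(2π)⁻¹ log ‖δₙ w - u‖ + o(1)` on the outer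
   boundary of `Vₙ`, `hₙ` is bounded away from `u` once `Fₙ` is close to a bounded `f`, and
   `a(vₙ - cₙ)/2 - Lₙ → (2π)⁻¹ log ‖z - u‖` when `δₙ vₙ → z ≠ u`.
1. **`flatEdge_core`** — the theorem for a bare bounded open `Ω` with the uniform exterior
   quadrant condition, at a point `x` of a *horizontal* edge with `Ω` *above*:
   * `Fₙ = G_{Vₙ}(cₙ, ·) + a(· - cₙ)/2 - Lₙ` (`a` the potential kernel, `Lₙ = -(2π)⁻¹ log δₙ + κ/2`)
     is lattice harmonic on `Vₙ` with boundary data `(2π)⁻¹ log ‖· - u‖ + o(1)`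
     (step 0), so `Fₙ → f` uniformly on `Vₙ`
     (`LatticeDirichletInteriorConvergence`: interior consistency + stability, driven to the
     boundary by the weak Beurling estimate), `f` the Green potential (`GreenPotentialBoundary`);
     hence `G_{Vₙ}(cₙ, vₙ) → g(z)` whenever `δₙvₙ → z ∈ Ω` (`g` the Green function with pole `u`)
     and `G_{Vₙ}(cₙ, ·)` is bounded away from `u`;
   * near `x`, `Vₙ` is the discrete half-plane `{v₁ ≥ ⌈im x/δₙ⌉}` with `aₙ` on its last row, and
     the boundary-row lemma (`HarmonicFlatBoundaryRow`) gives
     `G(cₙ,aₙ)/δₙ = G(cₙ, aₙ + J e₁)/((J+1)δₙ) + O(τ)`, `J = ⌊τ/δₙ⌋`;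
   * `G(cₙ, aₙ + J e₁)/((J+1)δₙ) → g(x+iτ)/τ → π⁻¹ im b re w′(x)/‖b - w(x)‖²` as `τ → 0`
     (`HalfPlaneGreenFunction.tendsto_green_div`; `w`, `w′` are real at `x`), and `G ≥ 0` forces
     `re w′(x) = |w′(x)|`.
2. **`dirichletGreen_map_iso`**, **`flatEdge_core_symm`** — graph automorphisms of `ℤ²` preserve
   the Dirichlet Green function, so `flatEdge_core` transports along `z ↦ conj z`, `z ↦ ±i z`
   (`flatEdge_below`, `flatEdge_rot`).
3. **`Kenyon2000_flatEdgePoissonKernelLimit_holds`** — `RectilinearJordanLocalStructure` supplies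
   the uniform exterior quadrant condition and the half-disc picture at `x` (four orientations).

Deviation from the printed proof: Kenyon compares `G` with the continuum Green function by a
fourth-order Taylor expansion *up to the boundary* (proof of Lemma 17), which needs `C⁴`
regularity of the continuum solution at `∂D` and fails at reflex corners of a rectilinear polygon;
we compare on interior compacts only and control the boundary layer by the weak Beurling estimate
and the discrete boundary-row lemma. Everything is proved; no named fact.

## References

* R. Kenyon, *Conformal invariance of domino tiling*, Ann. Probab. 28 (2000) 759–795, Thm 13,
  Thm 14, Lemma 17, Cor. 19 [Kenyon2000].
* G. F. Lawler, V. Limic, *Random Walk: A Modern Introduction* (2010), §4.4, §6.3, §8.1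
  [LawlerLimic2010].
-/

noncomputable section

namespace Literature.Probability.LatticeModels

open Set Metric Filter Complex _root_.Topology Finset
open scoped Real

/-! ### Elementary: a Lipschitz bound for the logarithm, mesh distances in coordinates -/

/-- `|log A - log B| ≤ |A - B| / m` for `A, B ≥ m > 0`. [folklore] -/
theorem abs_log_sub_log_le' {A B m : ℝ} (hm : 0 < m) (hA : m ≤ A) (hB : m ≤ B) :
    |Real.log A - Real.log B| ≤ |A - B| / m := by
  have hA0 : 0 < A := hm.trans_le hA
  have hB0 : 0 < B := hm.trans_le hB
  have h1 : Real.log A - Real.log B ≤ (A - B) / B := by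
    have := Real.log_le_sub_one_of_pos (div_pos hA0 hB0)
    rw [Real.log_div hA0.ne' hB0.ne'] at this
    rw [sub_div, div_self hB0.ne']
    exact this
  have h2 : Real.log B - Real.log A ≤ (B - A) / A := by
    have := Real.log_le_sub_one_of_pos (div_pos hB0 hA0)
    rw [Real.log_div hB0.ne' hA0.ne'] at this
    rw [sub_div, div_self hA0.ne']
    exact this
  rw [abs_le]
  constructor
  · have h3 : (B - A) / A ≤ |A - B| / m := by
      calc (B - A) / A ≤ |A - B| / A := by
            refine div_le_div_of_nonneg_right ?_ hA0.le
            rw [abs_sub_comm]; exact le_abs_self _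
        _ ≤ |A - B| / m := div_le_div_of_nonneg_left (abs_nonneg _) hm hA
    linarith
  · calc Real.log A - Real.log B ≤ (A - B) / B := h1
      _ ≤ |A - B| / B := div_le_div_of_nonneg_right (le_abs_self _) hB0.le
      _ ≤ |A - B| / m := div_le_div_of_nonneg_left (abs_nonneg _) hm hB

/-- The distance of two mesh points in coordinates:
`‖δv - δc‖ = δ √((v₀-c₀)² + (v₁-c₁)²)`. [folklore] -/
theorem dist_meshPoint_meshPoint {δ : ℝ} (hδ : 0 ≤ δ) (v c : Site 2) :
    dist (meshPoint δ v) (meshPoint δ c) =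
      δ * Real.sqrt ((((v 0 : ℤ) : ℝ) - c 0) ^ 2 + (((v 1 : ℤ) : ℝ) - c 1) ^ 2) := by
  have hsq : dist (meshPoint δ v) (meshPoint δ c) ^ 2 =
      (δ * Real.sqrt ((((v 0 : ℤ) : ℝ) - c 0) ^ 2 + (((v 1 : ℤ) : ℝ) - c 1) ^ 2)) ^ 2 := by
    rw [Complex.dist_eq, Complex.sq_norm, Complex.normSq_apply, Complex.sub_re, Complex.sub_im,
      meshPoint_re, meshPoint_im, meshPoint_re, meshPoint_im, mul_pow,
      Real.sq_sqrt (by positivity)]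
    ring
  exact (sq_eq_sq₀ dist_nonneg (by positivity)).1 hsq

/-- The distance of two mesh points is at most `2δ max(|v₀-c₀|, |v₁-c₁|)`. [folklore] -/
theorem dist_meshPoint_le_two_mul_max (δ : ℝ) (hδ : 0 ≤ δ) (v c : Site 2) :
    dist (meshPoint δ v) (meshPoint δ c) ≤ 2 * δ * max |(((v - c) 0 : ℤ) : ℝ)| |(((v - c) 1 : ℤ) : ℝ)| := by
  rw [Complex.dist_eq]
  refine (norm_le_abs_re_add_abs_im _).trans ?_
  rw [Complex.sub_re, Complex.sub_im, meshPoint_re, meshPoint_re, meshPoint_im, meshPoint_im,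
    ← mul_sub, ← mul_sub, abs_mul, abs_mul, abs_of_nonneg hδ]
  have h0 : |((v 0 : ℤ) : ℝ) - c 0| = |(((v - c) 0 : ℤ) : ℝ)| := by simp
  have h1 : |((v 1 : ℤ) : ℝ) - c 1| = |(((v - c) 1 : ℤ) : ℝ)| := by simp
  rw [h0, h1]
  have := le_max_left |(((v - c) 0 : ℤ) : ℝ)| |(((v - c) 1 : ℤ) : ℝ)|
  have := le_max_right |(((v - c) 0 : ℤ) : ℝ)| |(((v - c) 1 : ℤ) : ℝ)|
  nlinarith

/-! ### The potential kernel: normalisation identity and the limit `A → κ` -/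

/-- **Normalisation identity.** For sites `v ≠ c` and mesh `δ > 0`,
`a(v - c)/2 + (2π)⁻¹ log δ - κ/2 = (A(v - c) - κ)/2 + (2π)⁻¹ log ‖δv - δc‖` where
`A(y) = a(y) - (2π)⁻¹ log (y₀² + y₁²)`. [folklore] -/
theorem potentialNormalised_eq {δ : ℝ} (hδ : 0 < δ) {v c : Site 2} (hvc : v ≠ c) (κ : ℝ) :
    latticePotentialKernel 2 (v - c) / 2 + (2 * π)⁻¹ * Real.log δ - κ / 2 =
      (latticePotentialKernel 2 (v - c) -
          (2 * π)⁻¹ * Real.log ((((v - c) 0 : ℤ) : ℝ) ^ 2 + (((v - c) 1 : ℤ) : ℝ) ^ 2) - κ) / 2 +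
        (2 * π)⁻¹ * Real.log (dist (meshPoint δ v) (meshPoint δ c)) := by
  set q : ℝ := (((v - c) 0 : ℤ) : ℝ) ^ 2 + (((v - c) 1 : ℤ) : ℝ) ^ 2 with hq
  have hq' : (((v 0 : ℤ) : ℝ) - c 0) ^ 2 + (((v 1 : ℤ) : ℝ) - c 1) ^ 2 = q := by
    rw [hq]; push_cast [Pi.sub_apply]; ring
  have hqpos : 0 < q := by
    rw [hq]
    have h : (v - c) 0 ≠ 0 ∨ (v - c) 1 ≠ 0 := by
      by_contra hc
      push Not at hc
      apply hvc
      have : v - c = 0 := by ext i; fin_cases i <;> simp [hc.1, hc.2]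
      exact sub_eq_zero.1 this
    rcases h with h | h
    · have : (1 : ℝ) ≤ (((v - c) 0 : ℤ) : ℝ) ^ 2 := by
        have h' : (1 : ℤ) ≤ |(v - c) 0| := Int.one_le_abs h
        have : (1 : ℝ) ≤ |(((v - c) 0 : ℤ) : ℝ)| := by exact_mod_cast h'
        nlinarith [sq_abs (((v - c) 0 : ℤ) : ℝ)]
      positivity
    · have : (1 : ℝ) ≤ (((v - c) 1 : ℤ) : ℝ) ^ 2 := by
        have h' : (1 : ℤ) ≤ |(v - c) 1| := Int.one_le_abs h
        have : (1 : ℝ) ≤ |(((v - c) 1 : ℤ) : ℝ)| := by exact_mod_cast h'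
        nlinarith [sq_abs (((v - c) 1 : ℤ) : ℝ)]
      positivity
  rw [dist_meshPoint_meshPoint hδ.le, hq', Real.log_mul hδ.ne' (Real.sqrt_pos.2 hqpos).ne',
    Real.log_sqrt hqpos.le]
  ring

/-- **`A(y) → κ` as `max(|y₀|, |y₁|) → ∞`**, from the cofinite limit of
`LatticePotentialKernelAsymptotics.lean`: for `ε > 0` there is `N` with `|A(y) - κ| ≤ ε` whenever
`N ≤ max(|y₀|, |y₁|)`. [folklore] -/
theorem exists_forall_max_le_abs_sub_le {A : Site 2 → ℝ} {κ : ℝ}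
    (hA : Tendsto A cofinite (𝓝 κ)) {ε : ℝ} (hε : 0 < ε) :
    ∃ N : ℝ, 0 < N ∧ ∀ y : Site 2, N ≤ max |((y 0 : ℤ) : ℝ)| |((y 1 : ℤ) : ℝ)| → |A y - κ| ≤ ε := by
  have hev : ∀ᶠ y in cofinite, |A y - κ| ≤ ε := by
    have := hA.eventually (closedBall_mem_nhds κ hε)
    filter_upwards [this] with y hy
    rwa [Real.dist_eq] at hy
  rw [Filter.eventually_cofinite] at hev
  refine ⟨1 + ∑ y ∈ hev.toFinset, (|((y 0 : ℤ) : ℝ)| + |((y 1 : ℤ) : ℝ)|), ?_, fun y hy => ?_⟩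
  · have : 0 ≤ ∑ y ∈ hev.toFinset, (|((y 0 : ℤ) : ℝ)| + |((y 1 : ℤ) : ℝ)|) :=
      Finset.sum_nonneg fun _ _ => by positivity
    linarith
  · by_contra h
    have hyE : y ∈ hev.toFinset := hev.mem_toFinset.2 h
    have h1 : |((y 0 : ℤ) : ℝ)| + |((y 1 : ℤ) : ℝ)| ≤
        ∑ y ∈ hev.toFinset, (|((y 0 : ℤ) : ℝ)| + |((y 1 : ℤ) : ℝ)|) :=
      Finset.single_le_sum (f := fun y : Site 2 => |((y 0 : ℤ) : ℝ)| + |((y 1 : ℤ) : ℝ)|)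
        (fun _ _ => by positivity) hyE
    have h2 : max |((y 0 : ℤ) : ℝ)| |((y 1 : ℤ) : ℝ)| ≤ |((y 0 : ℤ) : ℝ)| + |((y 1 : ℤ) : ℝ)| :=
      max_le (le_add_of_nonneg_right (abs_nonneg _)) (le_add_of_nonneg_left (abs_nonneg _))
    linarith

/-- From a lower bound on the mesh distance to a lower bound on the lattice coordinates:
`‖δv - δc‖ ≥ ℓ` and `δ ≤ ℓ/(2N)` give `max(|(v-c)₀|, |(v-c)₁|) ≥ N`. [folklore] -/
theorem le_max_of_dist_meshPoint_ge {δ ℓ N : ℝ} (hδ : 0 < δ) (hN : 0 < N) {v c : Site 2}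
    (hℓ : ℓ ≤ dist (meshPoint δ v) (meshPoint δ c)) (hδN : δ ≤ ℓ / (2 * N)) :
    N ≤ max |(((v - c) 0 : ℤ) : ℝ)| |(((v - c) 1 : ℤ) : ℝ)| := by
  have h1 := dist_meshPoint_le_two_mul_max δ hδ.le v c
  set m := max |(((v - c) 0 : ℤ) : ℝ)| |(((v - c) 1 : ℤ) : ℝ)| with hm
  have h2 : ℓ ≤ 2 * δ * m := hℓ.trans h1
  have h3 : 2 * N * δ ≤ ℓ := by rwa [le_div_iff₀ (by positivity), mul_comm] at hδN
  by_contra h4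
  have h5 : m < N := lt_of_not_ge h4
  have h6 : 2 * δ * m < 2 * δ * N := by nlinarith
  nlinarith

/-! ### The normalised Green function is lattice harmonic -/

/-- Translation invariance of the five-point Laplacian. [folklore] -/
theorem latticeLaplacian_comp_sub (H : Site 2 → ℝ) (c v : Site 2) :
    latticeLaplacian (fun y => H (y - c)) v = latticeLaplacian H (v - c) := by
  simp only [latticeLaplacian, add_sub_right_comm]

/-- `Δ a = 2 δ₀` for the five-point Laplacian of `LatticeLaplacian.lean`. [folklore] -/
theorem latticeLaplacian_latticePotentialKernel_two (y : Site 2) :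
    latticeLaplacian (latticePotentialKernel 2) y = 2 * (if y = 0 then 1 else 0) := by
  rw [latticeLaplacian_eq_latticeLaplacianZd]
  exact latticeLaplacianZd_latticePotentialKernel (d := 2) two_pos y

/-- **The normalised Green function `G_V(c, ·) + a(· - c)/2 - L` is lattice harmonic on `V`**
(the poles cancel: `Δ G_V(c,·) = -δ_c`, `Δ a(· - c)/2 = δ_c`). Kenyon 2000, proof of Thm 13
("`G(v₁, v₂)` is the discrete harmonic function (as a function of `v₂`) on all of `U_ε`
(including at `v₁`) with boundary values `-G₀(v₁, v₂)`"). [cite: Kenyon2000, §5.2] -/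
theorem isLatticeHarmonicOn_greenNormalised (V : Finset (Site 2)) (c : Site 2) (L : ℝ) :
    IsLatticeHarmonicOn
      (fun v => dirichletGreen V c v + latticePotentialKernel 2 (v - c) / 2 - L) ↑V := by
  intro v hv
  have h1 : latticeLaplacian (dirichletGreen V c) v = -(if c = v then 1 else 0) := by
    rw [latticeLaplacian_eq_latticeLaplacianZd]
    have := neg_latticeLaplacianZd_dirichletGreen two_pos V c (Finset.mem_coe.1 hv)
    linarith
  have h2 : latticeLaplacian (fun y => latticePotentialKernel 2 (y - c) / 2) v =
      if v - c = 0 then 1 else 0 := by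
    have : (fun y => latticePotentialKernel 2 (y - c) / 2) =
        fun y => (1 / 2) * (fun y => latticePotentialKernel 2 (y - c)) y := by
      funext y; simp only; ring
    rw [this, latticeLaplacian_const_mul, latticeLaplacian_comp_sub,
      latticeLaplacian_latticePotentialKernel_two]
    split_ifs <;> ring
  have hfun : (fun v => dirichletGreen V c v + latticePotentialKernel 2 (v - c) / 2 - L) =
      (dirichletGreen V c + fun y => latticePotentialKernel 2 (y - c) / 2) + fun _ => -L := by
    funext y; simp [sub_eq_add_neg]
  rw [hfun, latticeLaplacian_add, latticeLaplacian_add, latticeLaplacian_const, h1, h2, add_zero]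
  by_cases hcv : c = v
  · subst hcv; simp
  · rw [if_neg hcv, if_neg (fun h => hcv (sub_eq_zero.1 h).symm)]; ring

/-! ### Boundary data of the normalised Green function -/

/-- **Boundary data.** Let `ball u r_u ⊆ Ω`, `δₙ → 0`, `Vₙ = {v | δₙ v ∈ closure Ω}`,
`δₙ cₙ → u`, and `A(y) = a(y) - (2π)⁻¹ log(y₀² + y₁²) → κ` (cofinite). Then, with
`Lₙ = -(2π)⁻¹ log δₙ + κ/2`, uniformly on the outer boundary of `Vₙ`:
`G_{Vₙ}(cₙ, w) + a(w - cₙ)/2 - Lₙ = (2π)⁻¹ log ‖δₙ w - u‖ + o(1)` — i.e. the normalised Green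
function has boundary values converging to the logarithmic potential of the pole. Kenyon 2000,
proof of Thm 13 ("the boundary values of `G^{P_ε}(v₁,v₂) - G₀(v₁,v₂)` are converging to
`(1/2π) log|v₂ - v₁|` …"). [cite: Kenyon2000, §5.2] -/
theorem greenNormalised_data {Ω : Set ℂ} {u : ℂ} {r_u : ℝ} (hru : 0 < r_u) (hball : ball u r_u ⊆ Ω)
    {δ : ℕ → ℝ} (hδ : ∀ n, 0 < δ n) (hδ0 : Tendsto δ atTop (𝓝 0))
    {V : ℕ → Finset (Site 2)} (hV : ∀ n v, v ∈ V n ↔ meshPoint (δ n) v ∈ closure Ω)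
    {c : ℕ → Site 2} (hcu : Tendsto (fun n => meshPoint (δ n) (c n)) atTop (𝓝 u)) {κ : ℝ}
    (hA : Tendsto (fun y : Site 2 => latticePotentialKernel 2 y -
      (2 * π)⁻¹ * Real.log (((y 0 : ℤ) : ℝ) ^ 2 + ((y 1 : ℤ) : ℝ) ^ 2)) cofinite (𝓝 κ))
    {ε : ℝ} (hε : 0 < ε) :
    ∀ᶠ n in atTop, ∀ w ∈ latticeOuterBoundary (↑(V n) : Set (Site 2)),
      |(dirichletGreen (V n) (c n) w + latticePotentialKernel 2 (w - c n) / 2 -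
          (-(2 * π)⁻¹ * Real.log (δ n) + κ / 2)) -
        (2 * π)⁻¹ * Real.log ‖meshPoint (δ n) w - u‖| ≤ ε := by
  obtain ⟨N, hN0, hN⟩ := exists_forall_max_le_abs_sub_le hA hε
  have hε' : 0 < π * ε * r_u / 2 := by positivity
  filter_upwards [hcu.eventually (ball_mem_nhds u (show (0 : ℝ) < min (r_u / 2) (π * ε * r_u / 2)
      by positivity)), hδ0.eventually (Iio_mem_nhds (show (0 : ℝ) < r_u / 2 / (2 * N) by positivity))]
    with n hcn hδn
  have hd0 : 0 < δ n := hδ n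
  have hcn' : dist (meshPoint (δ n) (c n)) u < min (r_u / 2) (π * ε * r_u / 2) := mem_ball.1 hcn
  have hcn1 : dist (meshPoint (δ n) (c n)) u < r_u / 2 := lt_of_lt_of_le hcn' (min_le_left _ _)
  have hcn2 : dist (meshPoint (δ n) (c n)) u < π * ε * r_u / 2 := lt_of_lt_of_le hcn' (min_le_right _ _)
  have hδn' : δ n < r_u / 2 / (2 * N) := hδn
  intro w hw
  have hwV : w ∉ V n := fun h => hw.1 (Finset.mem_coe.2 h)
  have hwcl : meshPoint (δ n) w ∉ closure Ω := fun h => hwV ((hV n w).2 h)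
  have hwu : r_u ≤ dist (meshPoint (δ n) w) u := by
    by_contra h
    exact hwcl (subset_closure (hball (mem_ball.2 (lt_of_not_ge h))))
  have hwc : r_u / 2 ≤ dist (meshPoint (δ n) w) (meshPoint (δ n) (c n)) := by
    linarith [dist_triangle (meshPoint (δ n) w) (meshPoint (δ n) (c n)) u]
  have hwc0 : w ≠ c n := by
    intro h; rw [h, dist_self] at hwc; linarith
  rw [dirichletGreen_of_not_mem_right (V n) (c n) hwV, zero_add]
  have key := potentialNormalised_eq hd0 hwc0 κ
  have hrw : latticePotentialKernel 2 (w - c n) / 2 - (-(2 * π)⁻¹ * Real.log (δ n) + κ / 2) =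
      latticePotentialKernel 2 (w - c n) / 2 + (2 * π)⁻¹ * Real.log (δ n) - κ / 2 := by ring
  rw [hrw, key]
  -- the two error terms
  have hAκ : |latticePotentialKernel 2 (w - c n) -
      (2 * π)⁻¹ * Real.log ((((w - c n) 0 : ℤ) : ℝ) ^ 2 + (((w - c n) 1 : ℤ) : ℝ) ^ 2) - κ| ≤ ε :=
    hN _ (le_max_of_dist_meshPoint_ge hd0 hN0 hwc hδn'.le)
  have hlog : |Real.log (dist (meshPoint (δ n) w) (meshPoint (δ n) (c n))) -
      Real.log ‖meshPoint (δ n) w - u‖| ≤ dist (meshPoint (δ n) (c n)) u / (r_u / 2) := by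
    refine (abs_log_sub_log_le' (by positivity) hwc ?_).trans ?_
    · rw [← dist_eq_norm]; linarith
    · refine div_le_div_of_nonneg_right ?_ (by positivity)
      rw [dist_eq_norm, dist_eq_norm]
      have := abs_norm_sub_norm_le (meshPoint (δ n) w - meshPoint (δ n) (c n)) (meshPoint (δ n) w - u)
      rwa [sub_sub_sub_cancel_left, norm_sub_rev u] at this
  have hlog' : (2 * π)⁻¹ * (dist (meshPoint (δ n) (c n)) u / (r_u / 2)) ≤ ε / 2 := by
    rw [div_div_eq_mul_div]
    have h1 : dist (meshPoint (δ n) (c n)) u * 2 / r_u ≤ π * ε := by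
      rw [div_le_iff₀ hru]; linarith
    calc (2 * π)⁻¹ * (dist (meshPoint (δ n) (c n)) u * 2 / r_u) ≤ (2 * π)⁻¹ * (π * ε) :=
          mul_le_mul_of_nonneg_left h1 (by positivity)
      _ = ε / 2 := by field_simp
  have hπ : 0 < (2 * π)⁻¹ := by positivity
  calc |(latticePotentialKernel 2 (w - c n) -
          (2 * π)⁻¹ * Real.log ((((w - c n) 0 : ℤ) : ℝ) ^ 2 + (((w - c n) 1 : ℤ) : ℝ) ^ 2) - κ) / 2 +
        (2 * π)⁻¹ * Real.log (dist (meshPoint (δ n) w) (meshPoint (δ n) (c n))) -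
        (2 * π)⁻¹ * Real.log ‖meshPoint (δ n) w - u‖|
      = |(latticePotentialKernel 2 (w - c n) -
          (2 * π)⁻¹ * Real.log ((((w - c n) 0 : ℤ) : ℝ) ^ 2 + (((w - c n) 1 : ℤ) : ℝ) ^ 2) - κ) / 2 +
        (2 * π)⁻¹ * (Real.log (dist (meshPoint (δ n) w) (meshPoint (δ n) (c n))) -
          Real.log ‖meshPoint (δ n) w - u‖)| := by ring_nf
    _ ≤ |(latticePotentialKernel 2 (w - c n) -
          (2 * π)⁻¹ * Real.log ((((w - c n) 0 : ℤ) : ℝ) ^ 2 + (((w - c n) 1 : ℤ) : ℝ) ^ 2) - κ) / 2| +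
        |(2 * π)⁻¹ * (Real.log (dist (meshPoint (δ n) w) (meshPoint (δ n) (c n))) -
          Real.log ‖meshPoint (δ n) w - u‖)| := abs_add_le _ _
    _ ≤ ε / 2 + ε / 2 := by
        refine add_le_add ?_ ?_
        · rw [abs_div, abs_two]; linarith
        · rw [abs_mul, abs_of_pos hπ]
          exact (mul_le_mul_of_nonneg_left hlog hπ.le).trans hlog'
    _ = ε := by ring

/-! ### A uniform bound on the Green function away from the pole -/

/-- **`G_{Vₙ}(cₙ, ·)` is bounded away from the pole, uniformly in `n`.** If the normalised
Green function is within `1` of a bounded function `f ∘ δₙ` on `Vₙ` (as the convergence theorem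
provides), then `|G_{Vₙ}(cₙ, v)| ≤ M` at every site `v` with `‖δₙ v - u‖ ≥ r`, for all large `n`.
[folklore] -/
theorem abs_dirichletGreen_le_of_far {Ω : Set ℂ} (hΩb : Bornology.IsBounded Ω) {u : ℂ}
    {δ : ℕ → ℝ} (hδ : ∀ n, 0 < δ n) (hδ0 : Tendsto δ atTop (𝓝 0))
    {V : ℕ → Finset (Site 2)} (hV : ∀ n v, v ∈ V n ↔ meshPoint (δ n) v ∈ closure Ω)
    {c : ℕ → Site 2} (hcu : Tendsto (fun n => meshPoint (δ n) (c n)) atTop (𝓝 u)) {κ : ℝ}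
    (hA : Tendsto (fun y : Site 2 => latticePotentialKernel 2 y -
      (2 * π)⁻¹ * Real.log (((y 0 : ℤ) : ℝ) ^ 2 + ((y 1 : ℤ) : ℝ) ^ 2)) cofinite (𝓝 κ))
    {f : ℂ → ℝ} {Bf : ℝ} (hfB : ∀ z ∈ closure Ω, |f z| ≤ Bf) {r : ℝ} (hr : 0 < r) :
    ∃ M : ℝ, 0 ≤ M ∧ ∀ᶠ n in atTop,
      (∀ v ∈ V n, |(dirichletGreen (V n) (c n) v + latticePotentialKernel 2 (v - c n) / 2 -
          (-(2 * π)⁻¹ * Real.log (δ n) + κ / 2)) - f (meshPoint (δ n) v)| ≤ 1) →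
      ∀ v : Site 2, r ≤ ‖meshPoint (δ n) v - u‖ → |dirichletGreen (V n) (c n) v| ≤ M := by
  obtain ⟨N, hN0, hN⟩ := exists_forall_max_le_abs_sub_le hA one_pos
  obtain ⟨Rad, hRad⟩ := (isBounded_iff_subset_closedBall (0 : ℂ)).1 hΩb.closure
  set Rm : ℝ := max Rad 1 with hRm
  have hsubRm : closure Ω ⊆ closedBall 0 Rm := hRad.trans (closedBall_subset_closedBall (le_max_left _ _))
  set D : ℝ := Rm + ‖u‖ + r / 2 with hD
  have hDpos : 0 < D := by have : (1 : ℝ) ≤ Rm := le_max_right _ _; positivity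
  set Lg : ℝ := max |Real.log (r / 2)| |Real.log D| with hLg
  refine ⟨1 + |Bf| + 1 / 2 + (2 * π)⁻¹ * Lg, by positivity, ?_⟩
  filter_upwards [hcu.eventually (ball_mem_nhds u (show (0 : ℝ) < r / 2 by positivity)),
    hδ0.eventually (Iio_mem_nhds (show (0 : ℝ) < r / 2 / (2 * N) by positivity))] with n hcn hδn
  intro hclose v hv
  have hd0 : 0 < δ n := hδ n
  have hcn' : dist (meshPoint (δ n) (c n)) u < r / 2 := mem_ball.1 hcn
  have hδn' : δ n < r / 2 / (2 * N) := hδn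
  by_cases hvV : v ∈ V n
  · have hvcl : meshPoint (δ n) v ∈ closure Ω := (hV n v).1 hvV
    have hvc : r / 2 ≤ dist (meshPoint (δ n) v) (meshPoint (δ n) (c n)) := by
      rw [← dist_eq_norm] at hv
      linarith [dist_triangle (meshPoint (δ n) v) (meshPoint (δ n) (c n)) u]
    have hvc' : dist (meshPoint (δ n) v) (meshPoint (δ n) (c n)) ≤ D := by
      have h1 : ‖meshPoint (δ n) v‖ ≤ Rm := by
        have := hsubRm hvcl; rwa [mem_closedBall, dist_zero_right] at this
      have h2 : dist (meshPoint (δ n) v) u ≤ Rm + ‖u‖ := by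
        rw [dist_eq_norm]; exact (norm_sub_le _ _).trans (by linarith)
      rw [hD]
      linarith [dist_triangle (meshPoint (δ n) v) u (meshPoint (δ n) (c n)), dist_comm u (meshPoint (δ n) (c n))]
    have hvc0 : v ≠ c n := by intro h; rw [h, dist_self] at hvc; linarith
    have key := potentialNormalised_eq hd0 hvc0 κ
    have hcl := hclose v hvV
    have hrw : latticePotentialKernel 2 (v - c n) / 2 - (-(2 * π)⁻¹ * Real.log (δ n) + κ / 2) =
        latticePotentialKernel 2 (v - c n) / 2 + (2 * π)⁻¹ * Real.log (δ n) - κ / 2 := by ring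
    rw [add_sub_assoc, hrw, key] at hcl
    have hAκ : |latticePotentialKernel 2 (v - c n) -
        (2 * π)⁻¹ * Real.log ((((v - c n) 0 : ℤ) : ℝ) ^ 2 + (((v - c n) 1 : ℤ) : ℝ) ^ 2) - κ| ≤ 1 :=
      hN _ (le_max_of_dist_meshPoint_ge hd0 hN0 hvc hδn'.le)
    have hlog : |Real.log (dist (meshPoint (δ n) v) (meshPoint (δ n) (c n)))| ≤ Lg := by
      have h1 : Real.log (r / 2) ≤ Real.log (dist (meshPoint (δ n) v) (meshPoint (δ n) (c n))) :=
        Real.log_le_log (by positivity) hvc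
      have h2 : Real.log (dist (meshPoint (δ n) v) (meshPoint (δ n) (c n))) ≤ Real.log D :=
        Real.log_le_log (lt_of_lt_of_le (by positivity) hvc) hvc'
      rw [abs_le]
      constructor
      · have := neg_abs_le (Real.log (r / 2))
        have := le_max_left |Real.log (r / 2)| |Real.log D|
        linarith
      · have := le_abs_self (Real.log D)
        have := le_max_right |Real.log (r / 2)| |Real.log D|
        linarith
    have hfv : |f (meshPoint (δ n) v)| ≤ |Bf| := (hfB _ hvcl).trans (le_abs_self _)
    have hπ : 0 < (2 * π)⁻¹ := by positivity
    -- `G = (G + P - f) + f - P` with `P` the normalised potential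
    set P : ℝ := (latticePotentialKernel 2 (v - c n) -
        (2 * π)⁻¹ * Real.log ((((v - c n) 0 : ℤ) : ℝ) ^ 2 + (((v - c n) 1 : ℤ) : ℝ) ^ 2) - κ) / 2 +
      (2 * π)⁻¹ * Real.log (dist (meshPoint (δ n) v) (meshPoint (δ n) (c n))) with hP
    have habs := abs_le.1 hcl
    have hA' := abs_le.1 hAκ
    have hf' := abs_le.1 hfv
    have hl' : |(2 * π)⁻¹ * Real.log (dist (meshPoint (δ n) v) (meshPoint (δ n) (c n)))| ≤
        (2 * π)⁻¹ * Lg := by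
      rw [abs_mul, abs_of_pos hπ]; exact mul_le_mul_of_nonneg_left hlog hπ.le
    have hl'' := abs_le.1 hl'
    have hPb : |P| ≤ 1 / 2 + (2 * π)⁻¹ * Lg := by
      rw [hP, abs_le]; constructor <;> linarith
    have hPb' := abs_le.1 hPb
    have hGeq : dirichletGreen (V n) (c n) v =
        (dirichletGreen (V n) (c n) v + P - f (meshPoint (δ n) v)) + f (meshPoint (δ n) v) - P := by
      ring
    rw [hGeq, abs_le]
    constructor <;> linarith
  · rw [dirichletGreen_of_not_mem_right (V n) (c n) hvV, abs_zero]
    positivity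

/-! ### The limit of the normalised potential at a moving site -/

/-- If `δₙ vₙ → z` and `δₙ cₙ → u ≠ z` then `A(vₙ - cₙ) → κ`. [folklore] -/
theorem tendsto_potentialError {δ : ℕ → ℝ} (hδ : ∀ n, 0 < δ n) (hδ0 : Tendsto δ atTop (𝓝 0))
    {v c : ℕ → Site 2} {z u : ℂ} (hz : Tendsto (fun n => meshPoint (δ n) (v n)) atTop (𝓝 z))
    (hc : Tendsto (fun n => meshPoint (δ n) (c n)) atTop (𝓝 u)) (hzu : z ≠ u) {κ : ℝ}
    (hA : Tendsto (fun y : Site 2 => latticePotentialKernel 2 y -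
      (2 * π)⁻¹ * Real.log (((y 0 : ℤ) : ℝ) ^ 2 + ((y 1 : ℤ) : ℝ) ^ 2)) cofinite (𝓝 κ)) :
    Tendsto (fun n => latticePotentialKernel 2 (v n - c n) -
      (2 * π)⁻¹ * Real.log ((((v n - c n) 0 : ℤ) : ℝ) ^ 2 + (((v n - c n) 1 : ℤ) : ℝ) ^ 2))
      atTop (𝓝 κ) := by
  rw [Metric.tendsto_nhds]
  intro ε hε
  obtain ⟨N, hN0, hN⟩ := exists_forall_max_le_abs_sub_le hA (half_pos hε)
  have hℓ : 0 < dist z u / 2 := by have := dist_pos.2 hzu; positivity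
  have hdist : Tendsto (fun n => dist (meshPoint (δ n) (v n)) (meshPoint (δ n) (c n))) atTop
      (𝓝 (dist z u)) := hz.dist hc
  filter_upwards [hdist.eventually (Ioi_mem_nhds (show dist z u / 2 < dist z u by linarith)),
    hδ0.eventually (Iio_mem_nhds (show (0 : ℝ) < dist z u / 2 / (2 * N) by positivity))] with n h1 h2
  have h1' : dist z u / 2 < dist (meshPoint (δ n) (v n)) (meshPoint (δ n) (c n)) := h1
  have h2' : δ n < dist z u / 2 / (2 * N) := h2
  have := hN _ (le_max_of_dist_meshPoint_ge (hδ n) hN0 h1'.le h2'.le)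
  rw [Real.dist_eq]
  linarith

/-- **Limit of the normalised potential.** If `δₙ vₙ → z` and `δₙ cₙ → u ≠ z` then
`a(vₙ - cₙ)/2 - Lₙ → (2π)⁻¹ log ‖z - u‖`. [folklore] -/
theorem tendsto_potentialNormalised {δ : ℕ → ℝ} (hδ : ∀ n, 0 < δ n) (hδ0 : Tendsto δ atTop (𝓝 0))
    {v c : ℕ → Site 2} {z u : ℂ} (hz : Tendsto (fun n => meshPoint (δ n) (v n)) atTop (𝓝 z))
    (hc : Tendsto (fun n => meshPoint (δ n) (c n)) atTop (𝓝 u)) (hzu : z ≠ u) {κ : ℝ}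
    (hA : Tendsto (fun y : Site 2 => latticePotentialKernel 2 y -
      (2 * π)⁻¹ * Real.log (((y 0 : ℤ) : ℝ) ^ 2 + ((y 1 : ℤ) : ℝ) ^ 2)) cofinite (𝓝 κ)) :
    Tendsto (fun n => latticePotentialKernel 2 (v n - c n) / 2 -
      (-(2 * π)⁻¹ * Real.log (δ n) + κ / 2)) atTop (𝓝 ((2 * π)⁻¹ * Real.log ‖z - u‖)) := by
  have hdist : Tendsto (fun n => dist (meshPoint (δ n) (v n)) (meshPoint (δ n) (c n))) atTop
      (𝓝 (dist z u)) := hz.dist hc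
  have hne : ∀ᶠ n in atTop, v n ≠ c n := by
    filter_upwards [hdist.eventually (Ioi_mem_nhds (show dist z u / 2 < dist z u by
      have := dist_pos.2 hzu; linarith))] with n h1 h2
    have h1' : dist z u / 2 < dist (meshPoint (δ n) (v n)) (meshPoint (δ n) (c n)) := h1
    rw [h2, dist_self] at h1'
    linarith [dist_nonneg (x := z) (y := u)]
  have heq : ∀ᶠ n in atTop, latticePotentialKernel 2 (v n - c n) / 2 -
      (-(2 * π)⁻¹ * Real.log (δ n) + κ / 2) =
      (latticePotentialKernel 2 (v n - c n) -
          (2 * π)⁻¹ * Real.log ((((v n - c n) 0 : ℤ) : ℝ) ^ 2 + (((v n - c n) 1 : ℤ) : ℝ) ^ 2) - κ) / 2 +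
        (2 * π)⁻¹ * Real.log (dist (meshPoint (δ n) (v n)) (meshPoint (δ n) (c n))) := by
    filter_upwards [hne] with n hn
    rw [← potentialNormalised_eq (hδ n) hn κ]
    ring
  refine Tendsto.congr' (EventuallyEq.symm heq) ?_
  have h1 := tendsto_potentialError hδ hδ0 hz hc hzu hA
  have h2 : Tendsto (fun n => Real.log (dist (meshPoint (δ n) (v n)) (meshPoint (δ n) (c n)))) atTop
      (𝓝 (Real.log ‖z - u‖)) := by
    rw [← dist_eq_norm]
    exact hdist.log (dist_pos.2 hzu).ne'
  have := ((h1.sub_const κ).div_const 2).add (h2.const_mul (2 * π)⁻¹)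
  simpa using this

open WeakBeurling ComplexConjugate
open Literature.Probability.RandomPlanarGeometry Literature.Probability.Percolation

/-! ### The lattice picture near a flat horizontal edge -/

/-- Near a flat horizontal edge with the domain above, membership in the discretisation is
`v₁ ≥ ⌈im x / δ⌉`. [folklore] -/
theorem mem_iff_ceil_le_of_flat {Ω : Set ℂ} {x : ℂ} {rx : ℝ}
    (hX : ∀ z : ℂ, dist z x < rx → (z ∈ closure Ω ↔ x.im ≤ z.im))
    {δ : ℝ} (hδ : 0 < δ) {V : Finset (Site 2)} (hV : ∀ v, v ∈ V ↔ meshPoint δ v ∈ closure Ω)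
    {v : Site 2} (hv : dist (meshPoint δ v) x < rx) : v ∈ V ↔ ⌈x.im / δ⌉ ≤ v 1 := by
  rw [hV v, hX _ hv, meshPoint_im, Int.ceil_le, div_le_iff₀ hδ, mul_comm]

/-- The distance of the mesh points of two sites is at most `δ (|Δ₀| + |Δ₁|)`. [folklore] -/
theorem dist_meshPoint_le_mul_add (δ : ℝ) (hδ : 0 ≤ δ) (y p : Site 2) :
    dist (meshPoint δ y) (meshPoint δ p) ≤ δ * (|((y 0 : ℤ) : ℝ) - p 0| + |((y 1 : ℤ) : ℝ) - p 1|) := by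
  rw [Complex.dist_eq]
  refine (norm_le_abs_re_add_abs_im _).trans ?_
  rw [Complex.sub_re, Complex.sub_im, meshPoint_re, meshPoint_re, meshPoint_im, meshPoint_im,
    ← mul_sub, ← mul_sub, abs_mul, abs_mul, abs_of_nonneg hδ, mul_add]

/-- **A boundary site with exactly one outside neighbour lies on the last row.** Near the flat
edge, if `p ∈ V` has exactly one neighbour off `V` then `p₁ = ⌈im x / δ⌉`. [folklore] -/
theorem row_eq_ceil_of_card_eq_one {Ω : Set ℂ} {x : ℂ} {rx : ℝ}
    (hX : ∀ z : ℂ, dist z x < rx → (z ∈ closure Ω ↔ x.im ≤ z.im))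
    {δ : ℝ} (hδ : 0 < δ) {V : Finset (Site 2)} (hV : ∀ v, v ∈ V ↔ meshPoint δ v ∈ closure Ω)
    {p : Site 2} (hp : p ∈ V) (hcard : (((zdGraph 2).neighborFinset p).filter (fun u => u ∉ V)).card = 1)
    (hpx : dist (meshPoint δ p) x + δ < rx) : p 1 = ⌈x.im / δ⌉ := by
  have hp1 : ⌈x.im / δ⌉ ≤ p 1 :=
    (mem_iff_ceil_le_of_flat hX hδ hV (by linarith)).1 hp
  by_contra hne
  have hlt : ⌈x.im / δ⌉ + 1 ≤ p 1 := by omega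
  -- then every neighbour is in `V`
  have hall : ((zdGraph 2).neighborFinset p).filter (fun u => u ∉ V) = ∅ := by
    refine Finset.filter_eq_empty_iff.2 fun u hu => ?_
    rw [SimpleGraph.mem_neighborFinset] at hu
    obtain ⟨k, rfl⟩ := exists_eq_add_cornerUnit_of_adj hu
    rw [not_not]
    have hdist : dist (meshPoint δ (p + cornerUnit k)) x < rx := by
      have h1 : dist (meshPoint δ (p + cornerUnit k)) (meshPoint δ p) ≤ δ := by
        refine (dist_meshPoint_le_mul_add δ hδ.le _ _).trans ?_
        rcases coord_step_of_stepKind (stepKind_add_cornerUnit p k) with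
          ⟨h0, h1⟩ | ⟨h0, h1⟩ | ⟨h0, h1⟩ | ⟨h0, h1⟩
        · rw [h0, h1]; push_cast; ring_nf; simp
        · rw [h0, h1]; push_cast; ring_nf; simp
        · rw [h0, h1]; push_cast; ring_nf; simp
        · rw [h0, h1]; push_cast; ring_nf; simp
      linarith [dist_triangle (meshPoint δ (p + cornerUnit k)) (meshPoint δ p) x]
    refine (mem_iff_ceil_le_of_flat hX hδ hV hdist).2 ?_
    rcases coord_step_of_stepKind (stepKind_add_cornerUnit p k) with
      ⟨-, h1⟩ | ⟨-, h1⟩ | ⟨-, h1⟩ | ⟨-, h1⟩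
    · omega
    · omega
    · omega
    · omega
  rw [hall, Finset.card_empty] at hcard
  exact zero_ne_one hcard

/-! ### The boundary-row estimate for the Green function near the edge -/

/-- **The Green function climbs linearly off the edge.** Let `h = G_V(c, ·)`, `V` the
discretisation at mesh `δ` of `Ω`, which near `x` (radius `rx`) is the closed upper half-disc;
`p ∈ V` on the last row `p₁ = ⌈im x/δ⌉` with `dist(δp, x) < r/4`, where `r ≤ rx/2`, `r ≤ r_u/4`,
`δ ≤ r/80`, the pole `c` with `dist(δc, u) < r_u/2 ≤ dist(x, u)/2`, and `|h| ≤ M` at the sites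
`v` with `‖δv - u‖ ≥ r_u/2`. Then for `J ≤ 2s`, `s = ⌊r/(16δ)⌋`:
`|h(p + J e₁) - (J+1) h(p)| ≤ K² M J (J+1)/(2s²)` (`abs_sub_mul_le_of_harmonic_above_row`).
[folklore] -/
theorem green_above_row {Ω : Set ℂ} {x u : ℂ} {rx ru r δ M : ℝ}
    (hX : ∀ z : ℂ, dist z x < rx → (z ∈ closure Ω ↔ x.im ≤ z.im))
    (hδ : 0 < δ) {V : Finset (Site 2)} (hV : ∀ v, v ∈ V ↔ meshPoint δ v ∈ closure Ω)
    (hr : 0 < r) (hrx : 2 * r ≤ rx) (hru : 4 * r ≤ ru) (hδr : 80 * δ ≤ r) (hxu : ru ≤ dist x u)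
    {c : Site 2} (hc : dist (meshPoint δ c) u < ru / 2)
    (hM0 : 0 ≤ M) (hM : ∀ v : Site 2, ru / 2 ≤ ‖meshPoint δ v - u‖ → |dirichletGreen V c v| ≤ M)
    {p : Site 2} (hp1 : p 1 = ⌈x.im / δ⌉) (hpx : dist (meshPoint δ p) x < r / 4)
    {J : ℕ} (hJ : J ≤ 2 * ⌊r / (16 * δ)⌋₊) :
    |dirichletGreen V c ![p 0, p 1 + J] - (J + 1) * dirichletGreen V c p| ≤
      topGradConst ^ 2 * M * J * (J + 1) / (2 * (⌊r / (16 * δ)⌋₊ : ℝ) ^ 2) := by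
  set s : ℕ := ⌊r / (16 * δ)⌋₊ with hs
  have hsδ : (s : ℝ) * δ ≤ r / 16 := by
    have := Nat.floor_le (show 0 ≤ r / (16 * δ) by positivity)
    rw [← hs] at this
    calc (s : ℝ) * δ ≤ r / (16 * δ) * δ := mul_le_mul_of_nonneg_right this hδ.le
      _ = r / 16 := by field_simp
  have hs4 : 4 ≤ s := by
    have h1 : (5 : ℝ) ≤ r / (16 * δ) := by rw [le_div_iff₀ (by positivity)]; linarith
    have h2 := Nat.lt_floor_add_one (r / (16 * δ))
    rw [← hs] at h2
    have : (4 : ℝ) < s := by linarith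
    exact_mod_cast this.le
  -- geometry of the box of sup-radius `8s + 1` about `p`: inside `B(x, rx)`, far from `u`
  have hbox : ∀ i j : ℤ, |i - p 0| ≤ 8 * s + 1 → |j - p 1| ≤ 8 * s + 1 →
      dist (meshPoint δ ![i, j]) x < rx ∧ ru / 2 ≤ ‖meshPoint δ ![i, j] - u‖ := by
    intro i j hi hj
    have h1 : dist (meshPoint δ ![i, j]) (meshPoint δ p) ≤ r + 2 * δ := by
      refine (dist_meshPoint_le_mul_add δ hδ.le _ _).trans ?_
      have hi' : |((i : ℤ) : ℝ) - p 0| ≤ 8 * s + 1 := by exact_mod_cast hi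
      have hj' : |((j : ℤ) : ℝ) - p 1| ≤ 8 * s + 1 := by exact_mod_cast hj
      simp only [Matrix.cons_val_zero, Matrix.cons_val_one, Matrix.cons_val_fin_one]
      nlinarith
    have h2 : dist (meshPoint δ ![i, j]) x < 2 * r := by
      linarith [dist_triangle (meshPoint δ ![i, j]) (meshPoint δ p) x]
    refine ⟨by linarith, ?_⟩
    rw [← dist_eq_norm]
    linarith [dist_triangle x (meshPoint δ ![i, j]) u, dist_comm x (meshPoint δ ![i, j])]
  have habs1 : ∀ (i : ℤ), p 0 - (8 * s + 1) ≤ i → i ≤ p 0 + (8 * s + 1) → |i - p 0| ≤ 8 * s + 1 :=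
    fun i h1 h2 => abs_le.2 ⟨by linarith, by linarith⟩
  refine abs_sub_mul_le_of_harmonic_above_row hs4 hM0 ?_ ?_ ?_ hJ
  · -- the row below is killed
    intro i hi1 hi2
    have hi := habs1 i hi1 hi2
    have hj : |p 1 - 1 - p 1| ≤ 8 * (s : ℤ) + 1 := by
      rw [show p 1 - 1 - p 1 = -1 by ring, abs_neg, abs_one]; omega
    obtain ⟨hd, -⟩ := hbox i (p 1 - 1) hi hj
    refine dirichletGreen_of_not_mem_right V c fun hmem => ?_
    have := (mem_iff_ceil_le_of_flat hX hδ hV hd).1 hmem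
    simp only [Matrix.cons_val_one, Matrix.cons_val_fin_one] at this
    omega
  · -- harmonic above the row (the pole is far)
    intro i j hi1 hi2 hj1 hj2
    have hi : |i - p 0| ≤ 8 * s + 1 := abs_le.2 ⟨by linarith, by linarith⟩
    have hj : |j - p 1| ≤ 8 * s + 1 := abs_le.2 ⟨by linarith, by linarith⟩
    obtain ⟨hd, hfar⟩ := hbox i j hi hj
    have hmem : (![i, j] : Site 2) ∈ V := by
      refine (mem_iff_ceil_le_of_flat hX hδ hV hd).2 ?_
      simp only [Matrix.cons_val_one, Matrix.cons_val_fin_one]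
      omega
    have hne : c ≠ ![i, j] := by
      intro hcij
      rw [← hcij, ← dist_eq_norm] at hfar
      linarith
    rw [latticeLaplacian_eq_latticeLaplacianZd]
    have := neg_latticeLaplacianZd_dirichletGreen two_pos V c hmem
    rw [if_neg hne] at this
    linarith
  · -- bounded on the box
    intro i j hi1 hi2 hj1 hj2
    have hi : |i - p 0| ≤ 8 * s + 1 := abs_le.2 ⟨by linarith, by linarith⟩
    have hj : |j - p 1| ≤ 8 * s + 1 := abs_le.2 ⟨by linarith, by linarith⟩
    exact hM _ (hbox i j hi hj).2

/-- The error coefficient of `green_above_row`, per unit of `(J+1)δ`: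
`K² M J/(2 s² δ) ≤ 512 K² M τ / r²` when `J ≤ τ/δ` and `s = ⌊r/(16δ)⌋`, `32 δ ≤ r`. [folklore] -/
theorem aboveRow_error_le {M r δ τ : ℝ} {J : ℕ} (hM0 : 0 ≤ M) (hr : 0 < r) (hδ : 0 < δ)
    (hδr : 32 * δ ≤ r) (hJ : (J : ℝ) ≤ τ / δ) :
    topGradConst ^ 2 * M * J / (2 * (⌊r / (16 * δ)⌋₊ : ℝ) ^ 2 * δ) ≤
      512 * topGradConst ^ 2 * M * τ / r ^ 2 := by
  set s : ℕ := ⌊r / (16 * δ)⌋₊ with hs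
  have hs1 : r / (32 * δ) ≤ s := by
    have h2 := Nat.lt_floor_add_one (r / (16 * δ))
    rw [← hs] at h2
    have h3 : (1 : ℝ) ≤ r / (32 * δ) := by rw [le_div_iff₀ (by positivity)]; linarith
    have h4 : r / (16 * δ) = 2 * (r / (32 * δ)) := by field_simp; ring
    linarith
  have hs0 : 0 < (s : ℝ) := lt_of_lt_of_le (by positivity) hs1
  have hK := topGradConst_pos
  have hτ : 0 ≤ τ := by
    have : (0 : ℝ) ≤ τ / δ := (Nat.cast_nonneg J).trans hJ
    exact (div_nonneg_iff.1 this).elim (fun h => h.1) fun h => absurd h.2 (not_le.2 hδ)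
  rw [div_le_div_iff₀ (by positivity) (by positivity)]
  -- `K² M J r² ≤ 512 K² M τ · 2 s² δ`
  have h1 : (J : ℝ) * δ ≤ τ := by rwa [le_div_iff₀ hδ] at hJ
  have h2 : r ^ 2 ≤ 1024 * (s : ℝ) ^ 2 * δ ^ 2 := by
    have h4 : r ≤ (s : ℝ) * (32 * δ) := by rwa [div_le_iff₀ (by positivity)] at hs1
    have h5 : r ^ 2 ≤ ((s : ℝ) * (32 * δ)) ^ 2 := pow_le_pow_left₀ hr.le h4 2
    have h6 : ((s : ℝ) * (32 * δ)) ^ 2 = 1024 * (s : ℝ) ^ 2 * δ ^ 2 := by ring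
    linarith
  have h3 : 0 ≤ topGradConst ^ 2 * M := by positivity
  calc topGradConst ^ 2 * M * J * r ^ 2 ≤ topGradConst ^ 2 * M * J * (1024 * (s : ℝ) ^ 2 * δ ^ 2) := by
        exact mul_le_mul_of_nonneg_left h2 (by positivity)
    _ = topGradConst ^ 2 * M * (J * δ) * (2 * (s : ℝ) ^ 2 * δ) * 512 := by ring
    _ ≤ topGradConst ^ 2 * M * τ * (2 * (s : ℝ) ^ 2 * δ) * 512 := by gcongr
    _ = 512 * topGradConst ^ 2 * M * τ * (2 * (s : ℝ) ^ 2 * δ) := by ring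

/-! ### The core theorem -/

set_option maxHeartbeats 1600000 in
/-- **Kenyon's flat-edge Poisson kernel limit, normalised orientation** (Kenyon 2000, Cor. 19 with
Thm 14 / Lemma 17). Let `Ω` be open and bounded with the uniform exterior quadrant condition, let
`x` be a point of a flat horizontal boundary edge with `Ω` above it
(`closure Ω ∩ B(x,rₓ) = {im ≥ im x}`, `Ω ∩ B(x,rₓ) = {im > im x}`), `w` holomorphic on an open
`U ⊇ Ω ∪ {x}` and bijective `Ω → ℍ`, `δₙ → 0`, `Vₙ = {v | δₙ v ∈ closure Ω}`, `aₙ ∈ Vₙ` with exactly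
one neighbour off `Vₙ` and `δₙ aₙ → x`, `u ∈ Ω` and `δₙ cₙ → u`. Then
`G_{Vₙ}(cₙ, aₙ)/δₙ → π⁻¹ · im w(u) · |w′(x)| / |w(u) - w(x)|²`. [cite: Kenyon2000, Cor. 19] -/
theorem flatEdge_core {Ω : Set ℂ} (hΩo : IsOpen Ω) (hΩb : Bornology.IsBounded Ω)
    {r₀ : ℝ} (hr₀ : 0 < r₀)
    (hUEQ : ∀ ζ ∈ frontier Ω, ∃ s₁ s₂ : ℝ, (s₁ = 1 ∨ s₁ = -1) ∧ (s₂ = 1 ∨ s₂ = -1) ∧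
      ∀ z : ℂ, s₁ * ζ.re < s₁ * z.re → s₂ * ζ.im < s₂ * z.im → dist z ζ < r₀ → z ∉ closure Ω)
    {x : ℂ} {rx : ℝ} (hrx : 0 < rx)
    (hX : ∀ z : ℂ, dist z x < rx → (z ∈ closure Ω ↔ x.im ≤ z.im) ∧ (z ∈ Ω ↔ x.im < z.im))
    {w : ℂ → ℂ} {U : Set ℂ} (hU : IsOpen U) (hΩU : Ω ⊆ U) (hxU : x ∈ U)
    (hw : DifferentiableOn ℂ w U) (hbij : BijOn w Ω {z : ℂ | 0 < z.im})
    {δ : ℕ → ℝ} (hδ : ∀ n, 0 < δ n) (hδ0 : Tendsto δ atTop (𝓝 0))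
    {V : ℕ → Finset (Site 2)} (hV : ∀ n v, v ∈ V n ↔ meshPoint (δ n) v ∈ closure Ω)
    {a : ℕ → Site 2}
    (ha : ∀ n, a n ∈ V n ∧ (((zdGraph 2).neighborFinset (a n)).filter (fun u => u ∉ V n)).card = 1)
    (hax : Tendsto (fun n => meshPoint (δ n) (a n)) atTop (𝓝 x))
    {u : ℂ} (hu : u ∈ Ω) {c : ℕ → Site 2}
    (hcu : Tendsto (fun n => meshPoint (δ n) (c n)) atTop (𝓝 u)) :
    Tendsto (fun n => dirichletGreen (V n) (c n) (a n) / δ n) atTop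
      (𝓝 (1 / Real.pi * ((w u).im * ‖deriv w x‖ / ‖w u - w x‖ ^ 2))) := by
  classical
  have hXc : ∀ z : ℂ, dist z x < rx → (z ∈ closure Ω ↔ x.im ≤ z.im) := fun z hz => (hX z hz).1
  have hx0 : dist x x < rx := by rw [dist_self]; exact hrx
  -- the pole and the marked point
  have hb : 0 < (w u).im := hbij.mapsTo hu
  have hxcl : x ∈ closure Ω := (hXc x hx0).2 le_rfl
  have hxΩ : x ∉ Ω := fun h => lt_irrefl _ (((hX x hx0).2).1 h)
  -- radii: `ball x rU ⊆ U`, `ball u ru ⊆ Ω`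
  obtain ⟨rU, hrU, hballU⟩ := Metric.isOpen_iff.1 hU x hxU
  obtain ⟨ru, hru, hballu⟩ := Metric.isOpen_iff.1 hΩo u hu
  have hxu : ru ≤ dist x u := by
    by_contra h
    exact hxΩ (hballu (mem_ball.2 (lt_of_not_ge h)))
  set r : ℝ := min (min rx rU) ru / 4 with hr
  have hr0 : 0 < r := by positivity
  have hm1 : min (min rx rU) ru ≤ rx := (min_le_left _ _).trans (min_le_left _ _)
  have hm2 : min (min rx rU) ru ≤ rU := (min_le_left _ _).trans (min_le_right _ _)
  have hm3 : min (min rx rU) ru ≤ ru := min_le_right _ _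
  have hrrx : 2 * r ≤ rx := by rw [hr]; linarith
  have hrrU : r < rU := by rw [hr]; linarith
  have hrru : 4 * r ≤ ru := by rw [hr]; linarith
  -- `w` and `w′` are real at `x`
  have hreal : ∀ t : ℝ, 0 < t → t < r → (w (x + t)).im = 0 := by
    intro t ht htr
    have hd : dist (x + t) x = t := by
      rw [dist_eq, add_sub_cancel_left, norm_real, Real.norm_eq_abs, abs_of_pos ht]
    have h := hX (x + t) (by rw [hd]; linarith)
    have hfr : (x + (t : ℂ)) ∈ frontier Ω := by
      rw [frontier, hΩo.interior_eq]
      refine ⟨h.1.2 (by simp), fun hΩ' => ?_⟩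
      have := (h.2).1 hΩ'
      simp at this
    exact im_eq_zero_of_mem_frontier hΩo hU hΩU hw hbij hfr (hballU (mem_ball.2 (by rw [hd]; linarith)))
  obtain ⟨hwx, hdwx⟩ :=
    im_deriv_eq_zero_of_real_on_segment (hw.differentiableAt (hU.mem_nhds hxU)) hr0 hreal
  -- the potential kernel constant
  obtain ⟨κ, hA⟩ := latticePotentialKernel_two_asymptotics
  -- the normalised Green functions, their data, the Green potential
  set Lc : ℕ → ℝ := fun n => -(2 * π)⁻¹ * Real.log (δ n) + κ / 2 with hLc
  set F : ℕ → Site 2 → ℝ := fun n v =>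
    dirichletGreen (V n) (c n) v + latticePotentialKernel 2 (v - c n) / 2 - Lc n with hF
  set Φ : ℂ → ℝ := fun z => (2 * π)⁻¹ * Real.log ‖z - u‖ with hΦ
  set f : ℂ → ℝ := fun z =>
    if z ∈ Ω then (2 * π)⁻¹ * Real.log ‖(w z - conj (w u)) / dslope w u z‖ else Φ z with hf
  have hfΩ : ∀ z ∈ Ω, f z = (2 * π)⁻¹ * Real.log ‖(w z - conj (w u)) / dslope w u z‖ :=
    fun z hz => by simp only [hf, if_pos hz]
  have hnotΩ : ∀ z ∈ frontier Ω, z ∉ Ω := fun z hz h => by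
    rw [frontier, hΩo.interior_eq] at hz; exact hz.2 h
  have hfb : ∀ z ∈ frontier Ω, f z = Φ z := fun z hz => by simp only [hf, if_neg (hnotΩ z hz)]
  have hfb' : ∀ z ∈ frontier Ω, f z = (2 * π)⁻¹ * Real.log ‖z - u‖ := hfb
  have hwΩ : DifferentiableOn ℂ w Ω := hw.mono hΩU
  have hfcont : ContinuousOn f (closure Ω) := continuousOn_greenDirichlet hΩo hwΩ hbij hu hfΩ hfb'
  have hfharm : InnerProductSpace.HarmonicOnNhd f Ω := harmonicOnNhd_greenDirichlet hΩo hwΩ hbij hu hfΩ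
  have hS : ∀ n v, v ∈ (↑(V n) : Set (Site 2)) ↔ meshPoint (δ n) v ∈ closure Ω :=
    fun n v => by rw [Finset.mem_coe]; exact hV n v
  have hFh : ∀ n, IsLatticeHarmonicOn (F n) ↑(V n) :=
    fun n => isLatticeHarmonicOn_greenNormalised (V n) (c n) (Lc n)
  have hΦc : ∀ ζ ∈ frontier Ω, ContinuousAt Φ ζ := fun ζ hζ =>
    continuousAt_logPotential (fun h => hnotΩ ζ hζ (h ▸ hu))
  have hdata : ∀ ε > 0, ∀ᶠ n in atTop, ∀ w' ∈ latticeOuterBoundary (↑(V n) : Set (Site 2)),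
      |F n w' - Φ (meshPoint (δ n) w')| ≤ ε :=
    fun ε hε => greenNormalised_data hru hballu hδ hδ0 hV hcu hA hε
  -- (1) uniform convergence `Fₙ → f` on `Vₙ`
  have hconv : ∀ ε > 0, ∀ᶠ n in atTop, ∀ v ∈ V n, |F n v - f (meshPoint (δ n) v)| ≤ ε := by
    intro ε hε
    have h := abs_sub_le_of_harmonicOnNhd hΩo hΩb hr₀ hUEQ hδ hδ0 hS hFh hΦc hdata hfcont hfb
      hfharm hε
    filter_upwards [h] with n hn v hv
    exact hn v (Finset.mem_coe.2 hv)
  -- (2) a uniform bound on `G` away from `u`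
  obtain ⟨Bf, hBf⟩ : ∃ Bf, ∀ z ∈ closure Ω, |f z| ≤ Bf := by
    obtain ⟨B, hB⟩ := hΩb.isCompact_closure.exists_bound_of_continuousOn hfcont
    exact ⟨B, fun z hz => by simpa [Real.norm_eq_abs] using hB z hz⟩
  obtain ⟨M, hM0, hMev⟩ := abs_dirichletGreen_le_of_far hΩb hδ hδ0 hV hcu hA hBf
    (show (0 : ℝ) < ru / 2 by positivity)
  have hMev' : ∀ᶠ n in atTop, ∀ v : Site 2, ru / 2 ≤ ‖meshPoint (δ n) v - u‖ →
      |dirichletGreen (V n) (c n) v| ≤ M := by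
    filter_upwards [hMev, hconv 1 one_pos] with n h1 h2
    exact h1 h2
  -- (3) the limit value
  set Lval : ℝ := π⁻¹ * ((w u).im * (deriv w x).re / ‖w u - w x‖ ^ 2) with hLval
  have hden : 0 < ‖w u - w x‖ := by
    rw [norm_pos_iff, sub_ne_zero]
    intro h
    rw [h, hwx] at hb
    exact lt_irrefl _ hb
  -- the Green function along the inward normal at `x`
  set gfun : ℝ → ℝ := fun s =>
    (2 * π)⁻¹ * Real.log (‖w (x + s * I) - conj (w u)‖ / ‖w (x + s * I) - w u‖) with hg
  have hglim : Tendsto (fun s => gfun s / s) (𝓝[>] 0) (𝓝 Lval) :=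
    (tendsto_green_div (hw.differentiableAt (hU.mem_nhds hxU)) hwx hdwx hb).mono_left
      (nhdsGT_le_nhdsNE 0)
  -- (4) the main limit
  have hmain : Tendsto (fun n => dirichletGreen (V n) (c n) (a n) / δ n) atTop (𝓝 Lval) := by
    refine Metric.tendsto_nhds.2 fun η hη => ?_
    set C₁ : ℝ := 512 * topGradConst ^ 2 * M / r ^ 2 with hC₁
    have hC₁0 : 0 ≤ C₁ := by positivity
    -- choose the height `τ`
    have hτev : ∀ᶠ τ in 𝓝[>] (0 : ℝ), dist (gfun τ / τ) Lval < η / 3 ∧ C₁ * τ < η / 3 ∧ τ < r / 16 := by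
      refine (Metric.tendsto_nhds.1 hglim _ (by positivity)).and (Eventually.and ?_ ?_)
      · have hc : Tendsto (fun τ : ℝ => C₁ * τ) (𝓝 0) (𝓝 (C₁ * 0)) := tendsto_id.const_mul C₁
        rw [mul_zero] at hc
        exact nhdsWithin_le_nhds (hc.eventually (Iio_mem_nhds (show (0 : ℝ) < η / 3 by positivity)))
      · exact nhdsWithin_le_nhds (Iio_mem_nhds (show (0 : ℝ) < r / 16 by positivity))
    obtain ⟨τ, ⟨hτ1, hτ2, hτ3⟩, hτ0⟩ := (hτev.and self_mem_nhdsWithin).exists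
    have hτ0 : 0 < τ := hτ0
    -- the interior point `zτ = x + iτ`
    set zτ : ℂ := x + τ * I with hzτ
    have hdzτ : dist zτ x = τ := by
      rw [hzτ, dist_eq, add_sub_cancel_left, norm_mul, norm_I, mul_one, norm_real, Real.norm_eq_abs,
        abs_of_pos hτ0]
    have hzτΩ : zτ ∈ Ω := ((hX zτ (by rw [hdzτ]; linarith)).2).2 (by simp [hzτ, hτ0])
    have hzτu : zτ ≠ u := by
      intro h
      have : dist x u = τ := by rw [← h, dist_comm, hdzτ]
      linarith
    -- the lifted heights `Jₙ δₙ → τ`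
    have hJle : ∀ n, (⌊τ / δ n⌋₊ : ℝ) * δ n ≤ τ := fun n => by
      have := Nat.floor_le (div_nonneg hτ0.le (hδ n).le)
      calc (⌊τ / δ n⌋₊ : ℝ) * δ n ≤ τ / δ n * δ n := mul_le_mul_of_nonneg_right this (hδ n).le
        _ = τ := div_mul_cancel₀ τ (hδ n).ne'
    have hJge : ∀ n, τ - δ n ≤ (⌊τ / δ n⌋₊ : ℝ) * δ n := fun n => by
      have h1 := Nat.lt_floor_add_one (τ / δ n)
      have h2 : τ < ((⌊τ / δ n⌋₊ : ℝ) + 1) * δ n := by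
        calc τ = τ / δ n * δ n := (div_mul_cancel₀ τ (hδ n).ne').symm
          _ < ((⌊τ / δ n⌋₊ : ℝ) + 1) * δ n := mul_lt_mul_of_pos_right h1 (hδ n)
      linarith
    have hJδ : Tendsto (fun n => (⌊τ / δ n⌋₊ : ℝ) * δ n) atTop (𝓝 τ) := by
      refine tendsto_of_tendsto_of_tendsto_of_le_of_le ?_ tendsto_const_nhds hJge hJle
      simpa using tendsto_const_nhds.sub hδ0
    have hJδ1 : Tendsto (fun n => ((⌊τ / δ n⌋₊ : ℝ) + 1) * δ n) atTop (𝓝 τ) := by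
      have h := hJδ.add hδ0
      rw [add_zero] at h
      exact h.congr' (Eventually.of_forall fun n => by ring)
    -- the lifted sites `vsₙ = aₙ + Jₙ e₁` and their mesh points
    have hvs_mesh : ∀ n, meshPoint (δ n) ![a n 0, a n 1 + ⌊τ / δ n⌋₊] =
        meshPoint (δ n) (a n) + (((⌊τ / δ n⌋₊ : ℝ) * δ n : ℝ) : ℂ) * I := by
      intro n
      apply Complex.ext
      · simp [meshPoint_re]
      · simp [meshPoint_im]; ring
    have hvsz : Tendsto (fun n => meshPoint (δ n) ![a n 0, a n 1 + ⌊τ / δ n⌋₊]) atTop (𝓝 zτ) := by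
      have hfun : (fun n => meshPoint (δ n) ![a n 0, a n 1 + ⌊τ / δ n⌋₊]) =
          fun n => meshPoint (δ n) (a n) + (((⌊τ / δ n⌋₊ : ℝ) * δ n : ℝ) : ℂ) * I := funext hvs_mesh
      rw [hfun, hzτ]
      have h1 : Tendsto (fun n => (((⌊τ / δ n⌋₊ : ℝ) * δ n : ℝ) : ℂ)) atTop (𝓝 (τ : ℂ)) :=
        (continuous_ofReal.tendsto τ).comp hJδ
      exact hax.add (h1.mul_const I)
    have hvsV : ∀ᶠ n in atTop, (![a n 0, a n 1 + ⌊τ / δ n⌋₊] : Site 2) ∈ V n := by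
      have : ∀ᶠ n in atTop, meshPoint (δ n) ![a n 0, a n 1 + ⌊τ / δ n⌋₊] ∈ Ω :=
        hvsz.eventually (hΩo.mem_nhds hzτΩ)
      filter_upwards [this] with n hn
      exact (hV n _).2 (subset_closure hn)
    -- `G(cₙ, vsₙ) → g(zτ) = gfun τ`
    have hGvs : Tendsto (fun n => dirichletGreen (V n) (c n) ![a n 0, a n 1 + ⌊τ / δ n⌋₊]) atTop
        (𝓝 (gfun τ)) := by
      have hFf : Tendsto (fun n => F n ![a n 0, a n 1 + ⌊τ / δ n⌋₊] -
          f (meshPoint (δ n) ![a n 0, a n 1 + ⌊τ / δ n⌋₊])) atTop (𝓝 0) := by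
        refine Metric.tendsto_nhds.2 fun ε hε => ?_
        filter_upwards [hconv (ε / 2) (half_pos hε), hvsV] with n hn hv
        rw [Real.dist_eq, sub_zero]
        exact (hn _ hv).trans_lt (half_lt_self hε)
      have hfz : Tendsto (fun n => f (meshPoint (δ n) ![a n 0, a n 1 + ⌊τ / δ n⌋₊])) atTop
          (𝓝 (f zτ)) := by
        have hcw := hfcont zτ (subset_closure hzτΩ)
        refine hcw.tendsto.comp ?_
        exact tendsto_nhdsWithin_iff.2 ⟨hvsz, by
          filter_upwards [hvsV] with n hn
          exact (hV n _).1 hn⟩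
      have hpot := tendsto_potentialNormalised hδ hδ0 hvsz hcu hzτu hA
      have hGeq : (fun n => dirichletGreen (V n) (c n) ![a n 0, a n 1 + ⌊τ / δ n⌋₊]) =
          fun n => (F n ![a n 0, a n 1 + ⌊τ / δ n⌋₊] - f (meshPoint (δ n) ![a n 0, a n 1 + ⌊τ / δ n⌋₊])) +
            f (meshPoint (δ n) ![a n 0, a n 1 + ⌊τ / δ n⌋₊]) -
            (latticePotentialKernel 2 (![a n 0, a n 1 + ⌊τ / δ n⌋₊] - c n) / 2 -
              (-(2 * π)⁻¹ * Real.log (δ n) + κ / 2)) := by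
        funext n; simp only [hF, hLc]; ring
      rw [hGeq]
      have hlim := (hFf.add hfz).sub hpot
      rw [zero_add] at hlim
      convert hlim using 2
      rw [hfΩ zτ hzτΩ, greenPotential_eq hbij hu hzτΩ hzτu]
      simp only [hg, hzτ]
      ring
    have hratio : Tendsto (fun n => dirichletGreen (V n) (c n) ![a n 0, a n 1 + ⌊τ / δ n⌋₊] /
        (((⌊τ / δ n⌋₊ : ℝ) + 1) * δ n)) atTop (𝓝 (gfun τ / τ)) :=
      hGvs.div hJδ1 hτ0.ne'
    -- (5) the boundary-row estimate, eventually
    have hBL : ∀ᶠ n in atTop,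
        |dirichletGreen (V n) (c n) ![a n 0, a n 1 + ⌊τ / δ n⌋₊] / (((⌊τ / δ n⌋₊ : ℝ) + 1) * δ n) -
          dirichletGreen (V n) (c n) (a n) / δ n| ≤ C₁ * τ := by
      filter_upwards [hMev', hδ0.eventually (Iio_mem_nhds (show (0 : ℝ) < r / 80 by positivity)),
        hax.eventually (ball_mem_nhds x (show (0 : ℝ) < r / 8 by positivity)),
        hcu.eventually (ball_mem_nhds u (show (0 : ℝ) < ru / 2 by positivity))] with n hMn hδn haxn hcn
      have hd0 := hδ n
      have hδn' : δ n < r / 80 := hδn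
      have haxn' : dist (meshPoint (δ n) (a n)) x < r / 8 := mem_ball.1 haxn
      have hcn' : dist (meshPoint (δ n) (c n)) u < ru / 2 := mem_ball.1 hcn
      -- `aₙ` lies on the last row
      have hrow : a n 1 = ⌈x.im / δ n⌉ :=
        row_eq_ceil_of_card_eq_one hXc hd0 (hV n) (ha n).1 (ha n).2 (by linarith)
      -- `J ≤ 2s`
      have hQ5 : (5 : ℝ) ≤ r / (16 * δ n) := by rw [le_div_iff₀ (by positivity)]; linarith
      have hfloorQ : r / (16 * δ n) - 1 < (⌊r / (16 * δ n)⌋₊ : ℝ) := by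
        have := Nat.lt_floor_add_one (r / (16 * δ n)); linarith
      have hs0 : (0 : ℝ) < (⌊r / (16 * δ n)⌋₊ : ℝ) := by linarith
      have hJQ : (⌊τ / δ n⌋₊ : ℝ) ≤ τ / δ n := Nat.floor_le (by positivity)
      have hτQ : τ / δ n < r / (16 * δ n) := by
        rw [div_lt_div_iff₀ hd0 (by positivity)]
        nlinarith
      have hJ2s : ⌊τ / δ n⌋₊ ≤ 2 * ⌊r / (16 * δ n)⌋₊ := by
        have : (⌊τ / δ n⌋₊ : ℝ) < 2 * (⌊r / (16 * δ n)⌋₊ : ℝ) := by linarith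
        exact_mod_cast this.le
      have key := green_above_row hXc hd0 (hV n) hr0 hrrx hrru (by linarith) hxu hcn' hM0 hMn hrow
        (by linarith) hJ2s
      have herr := aboveRow_error_le (τ := τ) hM0 hr0 hd0 (by linarith) hJQ
      have hpos : 0 < ((⌊τ / δ n⌋₊ : ℝ) + 1) * δ n := by positivity
      have e1 : dirichletGreen (V n) (c n) ![a n 0, a n 1 + ⌊τ / δ n⌋₊] / (((⌊τ / δ n⌋₊ : ℝ) + 1) * δ n) -
          dirichletGreen (V n) (c n) (a n) / δ n =
          (dirichletGreen (V n) (c n) ![a n 0, a n 1 + ⌊τ / δ n⌋₊] -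
            ((⌊τ / δ n⌋₊ : ℝ) + 1) * dirichletGreen (V n) (c n) (a n)) / (((⌊τ / δ n⌋₊ : ℝ) + 1) * δ n) := by
        field_simp
      rw [e1, abs_div, abs_of_pos hpos, div_le_iff₀ hpos]
      have hs0' : (⌊r / (16 * δ n)⌋₊ : ℝ) ≠ 0 := hs0.ne'
      calc |dirichletGreen (V n) (c n) ![a n 0, a n 1 + ⌊τ / δ n⌋₊] -
            ((⌊τ / δ n⌋₊ : ℝ) + 1) * dirichletGreen (V n) (c n) (a n)|
          ≤ topGradConst ^ 2 * M * ⌊τ / δ n⌋₊ * (⌊τ / δ n⌋₊ + 1) / (2 * (⌊r / (16 * δ n)⌋₊ : ℝ) ^ 2) := key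
        _ = topGradConst ^ 2 * M * ⌊τ / δ n⌋₊ / (2 * (⌊r / (16 * δ n)⌋₊ : ℝ) ^ 2 * δ n) *
              (((⌊τ / δ n⌋₊ : ℝ) + 1) * δ n) := by
            field_simp
        _ ≤ C₁ * τ * (((⌊τ / δ n⌋₊ : ℝ) + 1) * δ n) := by
            refine mul_le_mul_of_nonneg_right (herr.trans_eq ?_) hpos.le
            rw [hC₁]; ring
    -- (6) conclude the main limit
    filter_upwards [hBL, Metric.tendsto_nhds.1 hratio _ (show (0 : ℝ) < η / 3 by positivity)] with n h1 h2
    rw [Real.dist_eq] at h2 ⊢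
    have hτ1' : |gfun τ / τ - Lval| < η / 3 := by rwa [Real.dist_eq] at hτ1
    have h1' : |dirichletGreen (V n) (c n) (a n) / δ n -
        dirichletGreen (V n) (c n) ![a n 0, a n 1 + ⌊τ / δ n⌋₊] / (((⌊τ / δ n⌋₊ : ℝ) + 1) * δ n)| ≤ C₁ * τ := by
      rwa [abs_sub_comm] at h1
    have t1 := abs_sub_le (dirichletGreen (V n) (c n) (a n) / δ n)
      (dirichletGreen (V n) (c n) ![a n 0, a n 1 + ⌊τ / δ n⌋₊] / (((⌊τ / δ n⌋₊ : ℝ) + 1) * δ n)) Lval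
    have t2 := abs_sub_le
      (dirichletGreen (V n) (c n) ![a n 0, a n 1 + ⌊τ / δ n⌋₊] / (((⌊τ / δ n⌋₊ : ℝ) + 1) * δ n))
      (gfun τ / τ) Lval
    linarith
  -- (7) `Lval ≥ 0` forces `re w′(x) ≥ 0`, hence `‖w′(x)‖ = re w′(x)` and `Lval` is the target
  have hGpos : ∀ n, 0 ≤ dirichletGreen (V n) (c n) (a n) / δ n :=
    fun n => div_nonneg (dirichletGreen_nonneg two_pos _ _ _) (hδ n).le
  have hLval0 : 0 ≤ Lval := ge_of_tendsto' hmain hGpos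
  have hre0 : 0 ≤ (deriv w x).re := by
    by_contra hneg
    have h1 : (w u).im * (deriv w x).re / ‖w u - w x‖ ^ 2 < 0 :=
      div_neg_of_neg_of_pos (mul_neg_of_pos_of_neg hb (lt_of_not_ge hneg)) (by positivity)
    have h2 : Lval < 0 := by
      rw [hLval]
      exact mul_neg_of_pos_of_neg (by positivity) h1
    linarith
  have hnorm : ‖deriv w x‖ = (deriv w x).re := by
    have h1 : deriv w x = ((deriv w x).re : ℂ) := Complex.ext (by simp) (by simp [hdwx])
    conv_lhs => rw [h1]
    rw [norm_real, Real.norm_eq_abs, abs_of_nonneg hre0]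
  have hfinal : 1 / Real.pi * ((w u).im * ‖deriv w x‖ / ‖w u - w x‖ ^ 2) = Lval := by
    rw [hnorm, hLval, one_div]
  rw [hfinal]
  exact hmain



/-! ### Graph automorphisms of `ℤ²` and the Dirichlet Green function -/

/-- A graph automorphism maps neighbourhoods to neighbourhoods. [folklore] -/
theorem neighborFinset_map_iso (φ : zdGraph 2 ≃g zdGraph 2) (y : Site 2) :
    (zdGraph 2).neighborFinset (φ y) = ((zdGraph 2).neighborFinset y).map φ.toEquiv.toEmbedding := by
  ext w'
  simp only [SimpleGraph.mem_neighborFinset, Finset.mem_map, Equiv.coe_toEmbedding]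
  constructor
  · intro h
    refine ⟨φ.symm w', ?_, by simp⟩
    have := φ.symm.map_adj_iff.2 h
    simpa using this
  · rintro ⟨w, hw, rfl⟩
    exact φ.map_adj_iff.2 hw

/-- The Laplacian commutes with graph automorphisms: `Δ(H ∘ φ)(y) = (ΔH)(φ y)`. [folklore] -/
theorem latticeLaplacianZd_comp_iso (φ : zdGraph 2 ≃g zdGraph 2) (H : Site 2 → ℝ) (y : Site 2) :
    latticeLaplacianZd (H ∘ φ) y = latticeLaplacianZd H (φ y) := by
  rw [latticeLaplacianZd_eq_sum_neighborFinset, latticeLaplacianZd_eq_sum_neighborFinset,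
    neighborFinset_map_iso, Finset.sum_map]
  simp

/-- Membership in the image set. [folklore] -/
theorem mem_map_iso_iff (φ : zdGraph 2 ≃g zdGraph 2) (Λ : Finset (Site 2)) (y : Site 2) :
    φ y ∈ Λ.map φ.toEquiv.toEmbedding ↔ y ∈ Λ := by
  rw [Finset.mem_map]
  constructor
  · rintro ⟨w, hw, h⟩
    have h' : φ w = φ y := h
    rwa [← φ.injective h']
  · intro h
    exact ⟨y, h, rfl⟩

/-- **The Dirichlet Green function is invariant under graph automorphisms of `ℤ²`**:
`G_{φΛ}(φ x, φ y) = G_Λ(x, y)` (both solve `-Δ G = δ_x` on `Λ`, `G = 0` off `Λ`; uniqueness).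
[folklore] -/
theorem dirichletGreen_map_iso (φ : zdGraph 2 ≃g zdGraph 2) (Λ : Finset (Site 2)) (x y : Site 2) :
    dirichletGreen (Λ.map φ.toEquiv.toEmbedding) (φ x) (φ y) = dirichletGreen Λ x y := by
  set Λ' := Λ.map φ.toEquiv.toEmbedding with hΛ'
  set Df : Site 2 → ℝ := fun y => dirichletGreen Λ' (φ x) (φ y) - dirichletGreen Λ x y with hDf
  -- `Df` is harmonic on `Λ` and vanishes off `Λ`
  have hoff : ∀ w ∉ (↑Λ : Set (Site 2)), Df w = 0 := by
    intro w hw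
    have hw' : w ∉ Λ := fun h => hw (Finset.mem_coe.2 h)
    have hφw : φ w ∉ Λ' := fun h => hw' ((mem_map_iso_iff φ Λ w).1 h)
    simp only [hDf, dirichletGreen_of_not_mem_right _ _ hφw, dirichletGreen_of_not_mem_right _ _ hw',
      sub_self]
  have hharm : IsLatticeHarmonicOn Df ↑Λ := by
    intro w hw
    have hw' : w ∈ Λ := Finset.mem_coe.1 hw
    have hφw : φ w ∈ Λ' := (mem_map_iso_iff φ Λ w).2 hw'
    rw [latticeLaplacian_eq_latticeLaplacianZd]
    have h1 : latticeLaplacianZd (fun y => dirichletGreen Λ' (φ x) (φ y)) w =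
        -(if φ x = φ w then 1 else 0) := by
      have := latticeLaplacianZd_comp_iso φ (dirichletGreen Λ' (φ x)) w
      rw [Function.comp_def] at this
      rw [this]
      have := neg_latticeLaplacianZd_dirichletGreen two_pos Λ' (φ x) hφw
      linarith
    have h2 : latticeLaplacianZd (dirichletGreen Λ x) w = -(if x = w then 1 else 0) := by
      have := neg_latticeLaplacianZd_dirichletGreen two_pos Λ x hw'
      linarith
    have hDf' : Df = (fun y => dirichletGreen Λ' (φ x) (φ y)) - dirichletGreen Λ x := by
      funext y; simp [hDf]
    rw [hDf', latticeLaplacianZd_sub, h1, h2]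
    by_cases hxw : x = w
    · subst hxw; simp
    · rw [if_neg hxw, if_neg (fun h => hxw (φ.injective h))]; ring
  have hzero : IsLatticeHarmonicOn (fun _ => (0 : ℝ)) ↑Λ := fun w _ => latticeLaplacian_const 0 w
  by_cases hy : y ∈ Λ
  · have := hharm.eq_of_eq_boundary Λ.finite_toSet hzero (fun w hw => hoff w hw.1) y
      (Finset.mem_coe.2 hy)
    simp only [hDf] at this
    linarith
  · have := hoff y (fun h => hy (Finset.mem_coe.1 h))
    simp only [hDf] at this
    linarith

/-- The number of neighbours off the set is invariant. [folklore] -/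
theorem card_filter_not_mem_map_iso (φ : zdGraph 2 ≃g zdGraph 2) (Λ : Finset (Site 2)) (a : Site 2) :
    (((zdGraph 2).neighborFinset (φ a)).filter (fun u => u ∉ Λ.map φ.toEquiv.toEmbedding)).card =
      (((zdGraph 2).neighborFinset a).filter (fun u => u ∉ Λ)).card := by
  classical
  rw [neighborFinset_map_iso, Finset.filter_map, Finset.card_map]
  congr 1
  ext u
  have h := mem_map_iso_iff φ Λ u
  simp only [Finset.mem_filter, Function.comp_apply, Equiv.coe_toEmbedding, RelIso.coe_fn_toEquiv]
  rw [h]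

/-! ### Three lattice symmetries and their action on mesh points -/

/-- Adjacency is preserved by `(v₀, v₁) ↦ (v₀, -v₁)`. [folklore] -/
theorem adj_conjSite_iff (v w : Site 2) :
    (zdGraph 2).Adj (![v 0, -v 1] : Site 2) ![w 0, -w 1] ↔ (zdGraph 2).Adj v w := by
  rw [zdGraph_two_adj_iff, zdGraph_two_adj_iff]
  simp only [Matrix.cons_val_zero, Matrix.cons_val_one, Matrix.cons_val_fin_one]
  omega

/-- Adjacency is preserved by `(v₀, v₁) ↦ (-v₁, v₀)`. [folklore] -/
theorem adj_rotSite_iff (v w : Site 2) :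
    (zdGraph 2).Adj (![-v 1, v 0] : Site 2) ![-w 1, w 0] ↔ (zdGraph 2).Adj v w := by
  rw [zdGraph_two_adj_iff, zdGraph_two_adj_iff]
  simp only [Matrix.cons_val_zero, Matrix.cons_val_one, Matrix.cons_val_fin_one]
  omega

/-- Adjacency is preserved by `(v₀, v₁) ↦ (v₁, -v₀)`. [folklore] -/
theorem adj_rotInvSite_iff (v w : Site 2) :
    (zdGraph 2).Adj (![v 1, -v 0] : Site 2) ![w 1, -w 0] ↔ (zdGraph 2).Adj v w := by
  rw [zdGraph_two_adj_iff, zdGraph_two_adj_iff]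
  simp only [Matrix.cons_val_zero, Matrix.cons_val_one, Matrix.cons_val_fin_one]
  omega

/-- Mesh points under `(v₀, v₁) ↦ (v₀, -v₁)`: complex conjugation. [folklore] -/
theorem meshPoint_conjSite (δ : ℝ) (v : Site 2) :
    meshPoint δ ![v 0, -v 1] = conj (meshPoint δ v) := by
  apply Complex.ext <;> simp [meshPoint_re, meshPoint_im]

/-- Mesh points under `(v₀, v₁) ↦ (-v₁, v₀)`: multiplication by `i`. [folklore] -/
theorem meshPoint_rotSite (δ : ℝ) (v : Site 2) :
    meshPoint δ ![-v 1, v 0] = I * meshPoint δ v := by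
  apply Complex.ext <;> simp [meshPoint_re, meshPoint_im]

/-- Mesh points under `(v₀, v₁) ↦ (v₁, -v₀)`: multiplication by `-i`. [folklore] -/
theorem meshPoint_rotInvSite (δ : ℝ) (v : Site 2) :
    meshPoint δ ![v 1, -v 0] = -I * meshPoint δ v := by
  apply Complex.ext <;> simp [meshPoint_re, meshPoint_im]

/-! ### Transport of the core theorem along a symmetry -/

set_option maxHeartbeats 800000 in
/-- **The flat-edge limit in any orientation, by symmetry.** Let `σ` be an isometry of `ℂ` and
`φ` a graph automorphism of `ℤ²` with `δ φv = σ(δv)`, such that open quadrants at `σ ζ` pull back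
into open quadrants at `ζ` (`hquad`). Suppose `Ω`, `x`, `δₙ`, `Vₙ`, `aₙ`, `u`, `cₙ` are as in
`flatEdge_core` except that, *seen through `σ`*, the domain lies above a horizontal edge through
`σ x` (`hXσ`), and `w′` is holomorphic near `σ(Ω) ∪ {σ x}` and bijective `σ(Ω) → ℍ`. Then
`G_{Vₙ}(cₙ, aₙ)/δₙ → π⁻¹ im w′(σu) |(w′)′(σx)| / |w′(σu) - w′(σx)|²` (apply `flatEdge_core` to the
transported data `σ(Ω)`, `φ(Vₙ)`, … and use `dirichletGreen_map_iso`). [cite: Kenyon2000, Cor. 19] -/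
theorem flatEdge_core_symm (σ : ℂ ≃ᵢ ℂ) (φ : zdGraph 2 ≃g zdGraph 2)
    (hmesh : ∀ (δ : ℝ) (v : Site 2), meshPoint δ (φ v) = σ (meshPoint δ v))
    (hquad : ∀ s₁ s₂ : ℝ, (s₁ = 1 ∨ s₁ = -1) → (s₂ = 1 ∨ s₂ = -1) →
      ∃ t₁ t₂ : ℝ, (t₁ = 1 ∨ t₁ = -1) ∧ (t₂ = 1 ∨ t₂ = -1) ∧ ∀ ζ z : ℂ,
        t₁ * (σ ζ).re < t₁ * (σ z).re → t₂ * (σ ζ).im < t₂ * (σ z).im →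
          s₁ * ζ.re < s₁ * z.re ∧ s₂ * ζ.im < s₂ * z.im)
    {Ω : Set ℂ} (hΩo : IsOpen Ω) (hΩb : Bornology.IsBounded Ω)
    {r₀ : ℝ} (hr₀ : 0 < r₀)
    (hUEQ : ∀ ζ ∈ frontier Ω, ∃ s₁ s₂ : ℝ, (s₁ = 1 ∨ s₁ = -1) ∧ (s₂ = 1 ∨ s₂ = -1) ∧
      ∀ z : ℂ, s₁ * ζ.re < s₁ * z.re → s₂ * ζ.im < s₂ * z.im → dist z ζ < r₀ → z ∉ closure Ω)
    {x : ℂ} {rx : ℝ} (hrx : 0 < rx)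
    (hXσ : ∀ z : ℂ, dist z x < rx →
      (z ∈ closure Ω ↔ (σ x).im ≤ (σ z).im) ∧ (z ∈ Ω ↔ (σ x).im < (σ z).im))
    {w' : ℂ → ℂ} {U' : Set ℂ} (hU' : IsOpen U') (hΩU' : σ '' Ω ⊆ U') (hxU' : σ x ∈ U')
    (hw' : DifferentiableOn ℂ w' U') (hbij' : BijOn w' (σ '' Ω) {z : ℂ | 0 < z.im})
    {δ : ℕ → ℝ} (hδ : ∀ n, 0 < δ n) (hδ0 : Tendsto δ atTop (𝓝 0))
    {V : ℕ → Finset (Site 2)} (hV : ∀ n v, v ∈ V n ↔ meshPoint (δ n) v ∈ closure Ω)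
    {a : ℕ → Site 2}
    (ha : ∀ n, a n ∈ V n ∧ (((zdGraph 2).neighborFinset (a n)).filter (fun u => u ∉ V n)).card = 1)
    (hax : Tendsto (fun n => meshPoint (δ n) (a n)) atTop (𝓝 x))
    {u : ℂ} (hu : u ∈ Ω) {c : ℕ → Site 2}
    (hcu : Tendsto (fun n => meshPoint (δ n) (c n)) atTop (𝓝 u)) :
    Tendsto (fun n => dirichletGreen (V n) (c n) (a n) / δ n) atTop
      (𝓝 (1 / Real.pi * ((w' (σ u)).im * ‖deriv w' (σ x)‖ / ‖w' (σ u) - w' (σ x)‖ ^ 2))) := by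
  set Ω' : Set ℂ := σ '' Ω with hΩ'
  have hσh := σ.toHomeomorph
  have hclo : closure Ω' = σ '' closure Ω := (σ.toHomeomorph.image_closure Ω).symm
  have hfro : frontier Ω' = σ '' frontier Ω := (σ.toHomeomorph.image_frontier Ω).symm
  have hmemc : ∀ z, σ z ∈ closure Ω' ↔ z ∈ closure Ω := fun z => by
    rw [hclo]; exact σ.injective.mem_set_image
  have hmemo : ∀ z, σ z ∈ Ω' ↔ z ∈ Ω := fun z => σ.injective.mem_set_image
  -- the transported data
  have hΩo' : IsOpen Ω' := σ.toHomeomorph.isOpenMap Ω hΩo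
  have hΩb' : Bornology.IsBounded Ω' := σ.isometry.lipschitz.isBounded_image hΩb
  have hUEQ' : ∀ ζ' ∈ frontier Ω', ∃ s₁ s₂ : ℝ, (s₁ = 1 ∨ s₁ = -1) ∧ (s₂ = 1 ∨ s₂ = -1) ∧
      ∀ z : ℂ, s₁ * ζ'.re < s₁ * z.re → s₂ * ζ'.im < s₂ * z.im → dist z ζ' < r₀ → z ∉ closure Ω' := by
    intro ζ' hζ'
    rw [hfro] at hζ'
    obtain ⟨ζ, hζ, rfl⟩ := hζ'
    obtain ⟨s₁, s₂, hs₁, hs₂, hQ⟩ := hUEQ ζ hζ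
    obtain ⟨t₁, t₂, ht₁, ht₂, hT⟩ := hquad s₁ s₂ hs₁ hs₂
    refine ⟨t₁, t₂, ht₁, ht₂, fun z' h1 h2 h3 => ?_⟩
    obtain ⟨z, rfl⟩ := σ.surjective z'
    rw [hmemc]
    obtain ⟨h1', h2'⟩ := hT ζ z h1 h2
    refine hQ z h1' h2' ?_
    rwa [σ.dist_eq] at h3
  have hX' : ∀ z' : ℂ, dist z' (σ x) < rx →
      (z' ∈ closure Ω' ↔ (σ x).im ≤ z'.im) ∧ (z' ∈ Ω' ↔ (σ x).im < z'.im) := by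
    intro z' hz'
    obtain ⟨z, rfl⟩ := σ.surjective z'
    rw [σ.dist_eq] at hz'
    rw [hmemc, hmemo]
    exact hXσ z hz'
  set V' : ℕ → Finset (Site 2) := fun n => (V n).map φ.toEquiv.toEmbedding with hV'_eq
  have hV' : ∀ n v, v ∈ V' n ↔ meshPoint (δ n) v ∈ closure Ω' := by
    intro n v'
    obtain ⟨v, rfl⟩ := φ.surjective v'
    show φ v ∈ (V n).map φ.toEquiv.toEmbedding ↔ _
    rw [mem_map_iso_iff, hmesh, hmemc]
    exact hV n v
  have ha' : ∀ n, φ (a n) ∈ V' n ∧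
      (((zdGraph 2).neighborFinset (φ (a n))).filter (fun u => u ∉ V' n)).card = 1 := by
    intro n
    refine ⟨(mem_map_iso_iff φ (V n) (a n)).2 (ha n).1, ?_⟩
    show (((zdGraph 2).neighborFinset (φ (a n))).filter
      (fun u => u ∉ (V n).map φ.toEquiv.toEmbedding)).card = 1
    rw [card_filter_not_mem_map_iso]
    exact (ha n).2
  have hax' : Tendsto (fun n => meshPoint (δ n) (φ (a n))) atTop (𝓝 (σ x)) := by
    simp_rw [hmesh]
    exact (σ.continuous.tendsto x).comp hax
  have hu' : σ u ∈ Ω' := (hmemo u).2 hu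
  have hcu' : Tendsto (fun n => meshPoint (δ n) (φ (c n))) atTop (𝓝 (σ u)) := by
    simp_rw [hmesh]
    exact (σ.continuous.tendsto u).comp hcu
  have key := flatEdge_core hΩo' hΩb' hr₀ hUEQ' hrx hX' hU' hΩU' hxU' hw' hbij' hδ hδ0 hV' ha' hax'
    hu' hcu'
  have hG : ∀ n, dirichletGreen (V' n) (φ (c n)) (φ (a n)) = dirichletGreen (V n) (c n) (a n) :=
    fun n => dirichletGreen_map_iso φ (V n) (c n) (a n)
  simp_rw [hG] at key
  exact key


/-! ### The three symmetry instances -/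

/-- **Horizontal edge, domain below**: reduce to `flatEdge_core` by complex conjugation
(`w ↦ -conj ∘ w ∘ conj`, lattice `(v₀,v₁) ↦ (v₀,-v₁)`). [cite: Kenyon2000, Cor. 19] -/
theorem flatEdge_below {Ω : Set ℂ} (hΩo : IsOpen Ω) (hΩb : Bornology.IsBounded Ω)
    {r₀ : ℝ} (hr₀ : 0 < r₀)
    (hUEQ : ∀ ζ ∈ frontier Ω, ∃ s₁ s₂ : ℝ, (s₁ = 1 ∨ s₁ = -1) ∧ (s₂ = 1 ∨ s₂ = -1) ∧
      ∀ z : ℂ, s₁ * ζ.re < s₁ * z.re → s₂ * ζ.im < s₂ * z.im → dist z ζ < r₀ → z ∉ closure Ω)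
    {x : ℂ} {rx : ℝ} (hrx : 0 < rx)
    (hX : ∀ z : ℂ, dist z x < rx → (z ∈ closure Ω ↔ z.im ≤ x.im) ∧ (z ∈ Ω ↔ z.im < x.im))
    {w : ℂ → ℂ} {U : Set ℂ} (hU : IsOpen U) (hΩU : Ω ⊆ U) (hxU : x ∈ U)
    (hw : DifferentiableOn ℂ w U) (hbij : BijOn w Ω {z : ℂ | 0 < z.im})
    {δ : ℕ → ℝ} (hδ : ∀ n, 0 < δ n) (hδ0 : Tendsto δ atTop (𝓝 0))
    {V : ℕ → Finset (Site 2)} (hV : ∀ n v, v ∈ V n ↔ meshPoint (δ n) v ∈ closure Ω)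
    {a : ℕ → Site 2}
    (ha : ∀ n, a n ∈ V n ∧ (((zdGraph 2).neighborFinset (a n)).filter (fun u => u ∉ V n)).card = 1)
    (hax : Tendsto (fun n => meshPoint (δ n) (a n)) atTop (𝓝 x))
    {u : ℂ} (hu : u ∈ Ω) {c : ℕ → Site 2}
    (hcu : Tendsto (fun n => meshPoint (δ n) (c n)) atTop (𝓝 u)) :
    Tendsto (fun n => dirichletGreen (V n) (c n) (a n) / δ n) atTop
      (𝓝 (1 / Real.pi * ((w u).im * ‖deriv w x‖ / ‖w u - w x‖ ^ 2))) := by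
  set σ : ℂ ≃ᵢ ℂ := conjLIE.toIsometryEquiv with hσ
  have hσa : ∀ z, σ z = conj z := fun z => by
    rw [hσ, LinearIsometryEquiv.coe_toIsometryEquiv, conjLIE_apply]
  -- the transformed conformal map
  set w' : ℂ → ℂ := fun z => -(conj (w (conj z))) with hw'_eq
  set U' : Set ℂ := {z | conj z ∈ U} with hU'_eq
  have hU' : IsOpen U' := hU.preimage continuous_conj
  have hΩU' : σ '' Ω ⊆ U' := by
    rintro _ ⟨z, hz, rfl⟩
    show conj (σ z) ∈ U
    rw [hσa, conj_conj]; exact hΩU hz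
  have hxU' : σ x ∈ U' := by show conj (σ x) ∈ U; rw [hσa, conj_conj]; exact hxU
  have hw' : DifferentiableOn ℂ w' U' := by
    intro z hz
    have h1 : DifferentiableAt ℂ (conj ∘ w ∘ conj) z := by
      have := (hw.differentiableAt (hU.mem_nhds hz)).conj_conj
      rwa [conj_conj] at this
    exact h1.neg.differentiableWithinAt
  have hw'a : ∀ z, w' (σ z) = -conj (w z) := fun z => by
    simp only [hw'_eq, hσa, conj_conj]
  have hbij' : BijOn w' (σ '' Ω) {z : ℂ | 0 < z.im} := by
    refine ⟨?_, ?_, ?_⟩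
    · rintro _ ⟨z, hz, rfl⟩
      have := hbij.mapsTo hz
      simp only [mem_setOf_eq, hw'a, neg_im, conj_im, neg_neg] at this ⊢
      exact this
    · rintro _ ⟨z₁, hz₁, rfl⟩ _ ⟨z₂, hz₂, rfl⟩ h
      rw [hw'a, hw'a, neg_inj] at h
      have h' : w z₁ = w z₂ := by simpa using congrArg conj h
      rw [hbij.injOn hz₁ hz₂ h']
    · intro ζ hζ
      have hζ' : -conj ζ ∈ {z : ℂ | 0 < z.im} := by
        simp only [mem_setOf_eq, neg_im, conj_im, neg_neg] at hζ ⊢; exact hζ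
      obtain ⟨y, hy, hwy⟩ := hbij.surjOn hζ'
      refine ⟨σ y, ⟨y, hy, rfl⟩, ?_⟩
      rw [hw'a, hwy]; simp
  let φ : zdGraph 2 ≃g zdGraph 2 :=
    { toFun := fun v => ![v 0, -v 1], invFun := fun v => ![v 0, -v 1],
      left_inv := fun v => by ext i; fin_cases i <;> simp,
      right_inv := fun v => by ext i; fin_cases i <;> simp,
      map_rel_iff' := fun {v w} => adj_conjSite_iff v w }
  have key := flatEdge_core_symm σ φ
    (fun δ' v => by rw [hσa, ← meshPoint_conjSite]; rfl)
    (fun s₁ s₂ hs₁ hs₂ => ⟨s₁, -s₂, hs₁, by rcases hs₂ with h | h <;> simp [h], fun ζ z h1 h2 => by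
      simp only [hσa, conj_re, conj_im] at h1 h2
      exact ⟨h1, by linarith⟩⟩)
    hΩo hΩb hr₀ hUEQ hrx
    (fun z hz => by
      simp only [hσa, conj_im, neg_le_neg_iff, neg_lt_neg_iff]
      exact hX z hz)
    hU' hΩU' hxU' hw' hbij' hδ hδ0 hV ha hax hu hcu
  -- identify the limit
  have hval1 : (w' (σ u)).im = (w u).im := by rw [hw'a]; simp
  have hval2 : ‖deriv w' (σ x)‖ = ‖deriv w x‖ := by
    have hd : HasDerivAt (conj ∘ w ∘ conj) (conj (deriv w x)) (conj x) :=
      (hw.differentiableAt (hU.mem_nhds hxU)).hasDerivAt.conj_conj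
    have hd' : HasDerivAt w' (-(conj (deriv w x))) (σ x) := by rw [hσa]; exact hd.neg
    rw [hd'.deriv, norm_neg, Complex.norm_conj]
  have hval3 : ‖w' (σ u) - w' (σ x)‖ = ‖w u - w x‖ := by
    rw [hw'a, hw'a, show -conj (w u) - -conj (w x) = conj (w x - w u) by simp [map_sub]; ring,
      Complex.norm_conj, norm_sub_rev]
  rw [hval1, hval2, hval3] at key
  exact key

/-- **Vertical edge**: reduce to `flatEdge_core` by the rotation `z ↦ e z` with `e = ± i`
(`w ↦ w(ē ·)`, lattice rotation `φ`), given the half-disc picture seen through the rotation.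
[cite: Kenyon2000, Cor. 19] -/
theorem flatEdge_rot (e : ℂ) (he : e = I ∨ e = -I) (φ : zdGraph 2 ≃g zdGraph 2)
    (hmesh : ∀ (δ : ℝ) (v : Site 2), meshPoint δ (φ v) = e * meshPoint δ v)
    {Ω : Set ℂ} (hΩo : IsOpen Ω) (hΩb : Bornology.IsBounded Ω)
    {r₀ : ℝ} (hr₀ : 0 < r₀)
    (hUEQ : ∀ ζ ∈ frontier Ω, ∃ s₁ s₂ : ℝ, (s₁ = 1 ∨ s₁ = -1) ∧ (s₂ = 1 ∨ s₂ = -1) ∧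
      ∀ z : ℂ, s₁ * ζ.re < s₁ * z.re → s₂ * ζ.im < s₂ * z.im → dist z ζ < r₀ → z ∉ closure Ω)
    {x : ℂ} {rx : ℝ} (hrx : 0 < rx)
    (hX : ∀ z : ℂ, dist z x < rx →
      (z ∈ closure Ω ↔ (e * x).im ≤ (e * z).im) ∧ (z ∈ Ω ↔ (e * x).im < (e * z).im))
    {w : ℂ → ℂ} {U : Set ℂ} (hU : IsOpen U) (hΩU : Ω ⊆ U) (hxU : x ∈ U)
    (hw : DifferentiableOn ℂ w U) (hbij : BijOn w Ω {z : ℂ | 0 < z.im})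
    {δ : ℕ → ℝ} (hδ : ∀ n, 0 < δ n) (hδ0 : Tendsto δ atTop (𝓝 0))
    {V : ℕ → Finset (Site 2)} (hV : ∀ n v, v ∈ V n ↔ meshPoint (δ n) v ∈ closure Ω)
    {a : ℕ → Site 2}
    (ha : ∀ n, a n ∈ V n ∧ (((zdGraph 2).neighborFinset (a n)).filter (fun u => u ∉ V n)).card = 1)
    (hax : Tendsto (fun n => meshPoint (δ n) (a n)) atTop (𝓝 x))
    {u : ℂ} (hu : u ∈ Ω) {c : ℕ → Site 2}
    (hcu : Tendsto (fun n => meshPoint (δ n) (c n)) atTop (𝓝 u)) :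
    Tendsto (fun n => dirichletGreen (V n) (c n) (a n) / δ n) atTop
      (𝓝 (1 / Real.pi * ((w u).im * ‖deriv w x‖ / ‖w u - w x‖ ^ 2))) := by
  -- `ē = e⁻¹ = -e`, `|e| = 1`
  set eb : ℂ := -e with heb
  have hee : eb * e = 1 := by rcases he with rfl | rfl <;> simp [heb]
  have hee' : e * eb = 1 := by rw [mul_comm]; exact hee
  have he1 : ‖e‖ = 1 := by rcases he with rfl | rfl <;> simp
  have heb1 : ‖eb‖ = 1 := by rw [heb, norm_neg, he1]
  -- the rotation as an isometry
  have hiso : Isometry (fun z : ℂ => e * z) :=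
    Isometry.of_dist_eq fun p q => by rw [dist_eq, dist_eq, ← mul_sub, norm_mul, he1, one_mul]
  set σ : ℂ ≃ᵢ ℂ := IsometryEquiv.mk' (fun z => e * z) (fun z => eb * z)
    (fun z => by show e * (eb * z) = z; rw [← mul_assoc, hee', one_mul]) hiso with hσ
  have hσa : ∀ z, σ z = e * z := fun z => rfl
  -- the transformed conformal map
  set w' : ℂ → ℂ := fun z => w (eb * z) with hw'_eq
  set U' : Set ℂ := {z | eb * z ∈ U} with hU'_eq
  have hU' : IsOpen U' := hU.preimage (continuous_const.mul continuous_id)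
  have hebz : ∀ z, eb * (e * z) = z := fun z => by rw [← mul_assoc, hee, one_mul]
  have hΩU' : σ '' Ω ⊆ U' := by
    rintro _ ⟨z, hz, rfl⟩
    show eb * (σ z) ∈ U
    rw [hσa, hebz]; exact hΩU hz
  have hxU' : σ x ∈ U' := by show eb * (σ x) ∈ U; rw [hσa, hebz]; exact hxU
  have hw' : DifferentiableOn ℂ w' U' :=
    hw.comp ((differentiable_id.const_mul eb).differentiableOn) fun z hz => hz
  have hw'a : ∀ z, w' (σ z) = w z := fun z => by simp only [hw'_eq, hσa, hebz]
  have hbij' : BijOn w' (σ '' Ω) {z : ℂ | 0 < z.im} := by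
    refine ⟨?_, ?_, ?_⟩
    · rintro _ ⟨z, hz, rfl⟩
      rw [mem_setOf_eq, hw'a]; exact hbij.mapsTo hz
    · rintro _ ⟨z₁, hz₁, rfl⟩ _ ⟨z₂, hz₂, rfl⟩ h
      rw [hw'a, hw'a] at h
      rw [hbij.injOn hz₁ hz₂ h]
    · intro ζ hζ
      obtain ⟨y, hy, hwy⟩ := hbij.surjOn hζ
      exact ⟨σ y, ⟨y, hy, rfl⟩, by rw [hw'a, hwy]⟩
  -- quadrants seen through the rotation
  have hquad : ∀ s₁ s₂ : ℝ, (s₁ = 1 ∨ s₁ = -1) → (s₂ = 1 ∨ s₂ = -1) →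
      ∃ t₁ t₂ : ℝ, (t₁ = 1 ∨ t₁ = -1) ∧ (t₂ = 1 ∨ t₂ = -1) ∧ ∀ ζ z : ℂ,
        t₁ * (σ ζ).re < t₁ * (σ z).re → t₂ * (σ ζ).im < t₂ * (σ z).im →
          s₁ * ζ.re < s₁ * z.re ∧ s₂ * ζ.im < s₂ * z.im := by
    intro s₁ s₂ hs₁ hs₂
    rcases he with rfl | rfl
    · refine ⟨-s₂, s₁, by rcases hs₂ with h | h <;> simp [h], hs₁, fun ζ z h1 h2 => ?_⟩
      simp only [hσa, mul_re, mul_im, I_re, I_im, zero_mul, one_mul, zero_sub, zero_add] at h1 h2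
      exact ⟨h2, by linarith⟩
    · refine ⟨s₂, -s₁, hs₂, by rcases hs₁ with h | h <;> simp [h], fun ζ z h1 h2 => ?_⟩
      simp only [hσa, mul_re, mul_im, neg_re, neg_im, I_re, I_im, zero_mul, neg_mul,
        one_mul, zero_add] at h1 h2
      constructor
      · linarith
      · linarith
  have key := flatEdge_core_symm σ φ (fun δ' v => by rw [hmesh, hσa]) hquad hΩo hΩb hr₀ hUEQ hrx
    (fun z hz => by simp only [hσa]; exact hX z hz) hU' hΩU' hxU' hw' hbij' hδ hδ0 hV ha hax hu hcu
  -- identify the limit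
  have hval2 : ‖deriv w' (σ x)‖ = ‖deriv w x‖ := by
    have h0 : HasDerivAt w (deriv w x) (eb * (e * x)) := by
      rw [hebz]; exact (hw.differentiableAt (hU.mem_nhds hxU)).hasDerivAt
    have hd : HasDerivAt w' (deriv w x * (eb * 1)) (σ x) :=
      h0.comp (e * x) ((hasDerivAt_id (e * x)).const_mul eb)
    rw [hd.deriv, norm_mul, mul_one, heb1, mul_one]
  rw [hw'a, hw'a, hval2] at key
  exact key

/-! ### The named fact -/

/-- **Kenyon's flat-edge Poisson kernel limit** (Kenyon 2000, Cor. 19 with Thm 14 and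
Lemma 17): the discharge of `Kenyon2000_flatEdgePoissonKernelLimit`.
[cite: Kenyon2000, Cor. 19] -/
theorem Kenyon2000_flatEdgePoissonKernelLimit_holds : Kenyon2000_flatEdgePoissonKernelLimit := by
  intro D hrect x hx hflat w U hU hDU hxU hw hbij δ hδ hδ0 V hV a ha hax u hu c _hc hcu
  obtain ⟨r₀, hr₀, hUEQ⟩ := D.exists_uniform_exterior_quadrant hrect
  obtain ⟨r, hr, hfl⟩ := hflat
  rcases hfl with hhor | hver
  · rcases D.halfDisc_structure_of_flat_im hx hr hhor with habove | hbelow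
    · -- horizontal edge, domain above: the core theorem
      exact flatEdge_core D.isOpen D.isBounded hr₀ hUEQ hr
        (fun z hz => ⟨habove.1 z hz, habove.2 z hz⟩) hU hDU hxU hw hbij hδ hδ0 hV ha hax hu hcu
    · -- horizontal edge, domain below: conjugate
      exact flatEdge_below D.isOpen D.isBounded hr₀ hUEQ hr
        (fun z hz => ⟨hbelow.1 z hz, hbelow.2 z hz⟩) hU hDU hxU hw hbij hδ hδ0 hV ha hax hu hcu
  · rcases D.halfDisc_structure_of_flat_re hx hr hver with hright | hleft
    · -- vertical edge, domain to the right: rotate by `+90°`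
      let φ : zdGraph 2 ≃g zdGraph 2 :=
        { toFun := fun v => ![-v 1, v 0], invFun := fun v => ![v 1, -v 0],
          left_inv := fun v => by ext i; fin_cases i <;> simp,
          right_inv := fun v => by ext i; fin_cases i <;> simp,
          map_rel_iff' := fun {v w} => adj_rotSite_iff v w }
      refine flatEdge_rot I (Or.inl rfl) φ (fun δ' v => by rw [← meshPoint_rotSite]; rfl) D.isOpen
        D.isBounded hr₀ hUEQ hr (fun z hz => ?_) hU hDU hxU hw hbij hδ hδ0 hV ha hax hu hcu
      simp only [mul_im, I_re, I_im, zero_mul, one_mul, zero_add]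
      exact ⟨hright.1 z hz, hright.2 z hz⟩
    · -- vertical edge, domain to the left: rotate by `-90°`
      let φ : zdGraph 2 ≃g zdGraph 2 :=
        { toFun := fun v => ![v 1, -v 0], invFun := fun v => ![-v 1, v 0],
          left_inv := fun v => by ext i; fin_cases i <;> simp,
          right_inv := fun v => by ext i; fin_cases i <;> simp,
          map_rel_iff' := fun {v w} => adj_rotInvSite_iff v w }
      refine flatEdge_rot (-I) (Or.inr rfl) φ (fun δ' v => by rw [← meshPoint_rotInvSite]; rfl)
        D.isOpen D.isBounded hr₀ hUEQ hr (fun z hz => ?_) hU hDU hxU hw hbij hδ hδ0 hV ha hax hu hcu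
      simp only [mul_im, neg_im, I_re, I_im, zero_mul, neg_mul, one_mul, zero_add,
        neg_le_neg_iff, neg_lt_neg_iff]
      exact ⟨hleft.1 z hz, hleft.2 z hz⟩

end Literature.Probability.LatticeModels
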